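import Summits.AnomalousDissipation.AnomalousDissipation.Theses.MarginalStabilityChain
import Literature.Analysis.ODE.LinearSecondOrder
import Literature.Analysis.ODE.ConstantCoefficientSolutionSpace

/-!
# Disproof of `BurgersLayerKH` (stmt-AnomalousDissipation-3008) — standing-adversary work file

Crux (route `MarginalStabilityChain`, rank 3): ν-uniform Kelvin–Helmholtz instability of the exact
Burgers vortex layer in similarity variables — `∃ Re₂ c₀ > 0, ∀ Re ≥ Re₂, ∃` an eigenmode
`(α > 0, σ, ψ ∈ C⁴)` of `σω = −iαRe(Uω + U''ψ) + ω + yω' + ω'' − α²ω`, `ω = −(ψ'' − α²ψ)`,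
`U = ∫₀^y e^{−s²/2}`, with `re σ ≥ c₀·Re`, `ψ → 0` at `±∞`, `|ω| ≤ C e^{−y²/4}`, `ψ ≢ 0`.

VERDICT SO FAR: the crux RESISTS every cheap attack; it is almost certainly TRUE. What is landed
here is negative KNOWLEDGE about it (which hypotheses are load-bearing, what cannot be the
mechanism), all sorry-free (`lean check` rc 0).

## Findings (index; details in the docstrings below)

* ELABORATION: rc 0 (W.lean); body re-read symbol by symbol = the similarity-variable linearised
  stretched-vorticity equation about `Ω = −Re·U'` (steady: `−yΩ' = Ω + Ω''`); `σ = −iαRe·c`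
  recovers Rayleigh; matches Beronov–Kida 1995 eq. (2.7)/(2.9) (`c_ours = √(π/2)·c_BK`,
  `R_BK = √(π/2)·Re`, same length unit `δ = (ν/γ)^{1/2}`, time unit `1/γ`, `re σ = αR·c_{i,BK}`).
* NO JUNK WITNESS (§1): dropping `ψ ≢ 0` makes the crux trivially TRUE (`trivial_without_nonzero`);
  with it there is no "ghost" mode: `ω ≡ 0` forces `ψ ≡ 0` (`psi_eq_zero_of_vorticity_eq_zero`,
  `vorticity_ne_zero`), so every admissible witness is a genuine eigenfunction.
* LOAD-BEARING HYPOTHESES (§2, §3 — theorems):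
  - the inflection-point coupling `U''ψ` is THE mechanism: with that single term deleted
    (`BurgersLayerKHWithoutCoupling`) the statement is FALSE (`burgersLayerKH_false_without_coupling`):
    advection by ANY real profile, stretching `+ω`, compression `yω'` and diffusion give
    `re σ ≤ −α²` for every Gaussian-class mode at EVERY `Re` (`re_le_of_noCoupling`) — in particular
    the vortex-stretching amplification `+ω` never destabilises (the OU gap absorbs it);
  - the threshold `Re₂` is load-bearing: demanded at every `Re` (`BurgersLayerKHAllRe`) the statement
    is FALSE (`burgersLayerKH_false_forall_Re`) because at `Re = 0` every admissible mode has
    `re σ ≤ −α²` (`re_le_at_Re_zero` = the `Re = 0` case of item `BurgersLayerLowRe`, stmt-3010,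
    proved in the crux's exact class);
  - engine: the WEBER ENERGY LEMMA (`weber_energy`, `weber_complex`): a bounded C² solution of
    `W'' = (y²/4 + μ + iν(y))W` with real `μ > −½` vanishes — Gaussian conjugation `W = e^{y²/4}ω`
    of the Ornstein–Uhlenbeck part, Hermite ground energy `½`; boundary terms handled WITHOUT any
    a-priori decay of `ω'` (a bounded function cannot have derivative bounded away from 0).
* LOAD-BEARING (§3c, theorem): the eigenpair cannot be REAL — with `im σ = 0` and `im ψ ≡ 0`
  the imaginary part of the equation kills the Rayleigh coupling pointwise and `re σ ≤ −α²`
  (`re_le_of_real_mode`); so `BurgersLayerKHRealMode` (crux + real eigenpair) is FALSE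
  (`burgersLayerKH_false_real_mode`): the KH eigenfunction needs a phase tilt against the shear
  (standing modes `im σ = 0` are expected — BK1995 — but then `ψ` is genuinely complex).
* NOT load-bearing (information for the prover): the Gaussian class `|ω| ≤ Ce^{−y²/4}` is what
  excludes the algebraic branch `ω ∼ |y|^{−κ}`, `re κ = 1 − α² − re σ`; for `re σ > 1 − α²` that
  branch GROWS, so in the KH regime (`re σ ≥ c₀Re ≫ 1`) the class condition follows from `ψ → 0`
  alone — the decay clause costs the prover nothing there (it matters only for `BurgersLayerLowRe`).
* LITERATURE (Beronov–Kida 1995, RIMS Kōkyūroku 921, 58–88 = preprint of Phys. Fluids 8 (1996)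
  1024; fetched, pp. 58–73 read): inviscid short-wave cutoff `α_cr = 0.733` ((3.35) p. 68),
  `α_cr(R) = 0.733 − 0.863/R + O(R⁻²)` ((3.39) p. 69), finite critical Reynolds number `R_cr = 1`
  (p. 73; `Re_c = √(2/π) ≈ 0.80` here) at the LONG-wave end, no lower branch, neutral modes standing;
  p. 67: "y = 0 is not a turning point … viscous solutions play no role in the large Reynolds number
  limit" — the `Re → ∞` limit at fixed `α` in the unstable band is a REGULAR perturbation of the
  Rayleigh mode (`c_i > 0`, no critical layer). Neutral `α` at `R = 5, 10, 20, ∞`: 0.57, 0.65, 0.69,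
  0.73 (p. 73, vs Lin–Corcos 1984 Fig. 16). Everything in print SUPPORTS the crux.
* NUMERICS (kit job j004789, §4; Chebyshev collocation N = 200/260 on [−10,10]/[−12,12] of the
  `W = e^{y²/4}ω` form — the Gaussian class becomes a Dirichlet problem — exact Robin closure for ψ;
  sanity: the Re = 0 spectrum {−α² − n} is reproduced to 1e−13; N-convergence to 1e−11): ONE unstable
  eigenvalue, REAL (standing, |im σ| < 1e−11), for every Re ≥ 1; `max_α re σ / Re` = 0.0012 (Re=1),
  0.038 (2), 0.113 (5), 0.149 (10), 0.182 (50), 0.189 (200), 0.191 (1000) ↗ the Rayleigh value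
  `max αc_i = 0.1915` at `α* = 0.34` (erf profile); empirically `σ_max(Re) ≈ 0.1915·Re − 0.45`;
  unstable band `(0, α_edge)` with `α_edge ∈ (0.72, 0.74)` at Re = 200, 1000 (BK: 0.733 − 0.863/R);
  critical `Re_c ≈ 0.81` by bisection (BK: `R_cr = 1` ⇔ 0.798). At fixed α = 0.3 / 0.4 / 0.5 the ratio
  `re σ/Re` rises monotonically to 0.189 / 0.187 / 0.159 (Re = 10⁴). The crux holds numerically with
  room to spare: e.g. `Re₂ = 10, c₀ = 0.14` (α = 0.34), or `Re₂ = 50, c₀ = 0.18`.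
* WHY IT RESISTS: a disproof needs `sup re σ = o(Re)`, i.e. the Rayleigh problem of the erf
  profile to be STABLE; but the profile is odd, monotone, class K⁺ (`K = −U''/U = y e^{−y²/2}/U(y)
  ∈ (0, 1]`), `−∂² − K` has a bound state on `ℝ` (1-D well; tree tool
  `Literature.Analysis.ODE.exists_boundState_of_rayleigh`), hence a neutral mode at `α_s = 0.733`
  and unstable modes below it (Lin 2003 class-K⁺ theory; BK numerics); for fixed `α` in the band
  `σ(Re) = Re·s₀(α) + O(1)`, `re s₀ = αc_i > 0`, and §2 shows the `O(1)` part is dissipative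
  (`re ≤ −α²` without coupling), so nothing can cancel the `O(Re)` growth. The honest gap is a
  THEOREM-LEVEL one (Rayleigh instability of the erf layer on `ℝ` + regular perturbation in the
  Gaussian class), not a truth-level one.
* TIGHTNESS (§3, theorems): for every Gaussian-class mode of the FULL equation,
  `re σ + α² ≤ √(π/2)·|Re|` (`re_add_sq_le_of_mode`: forced Weber inequality + Green's-function sup
  bound `‖ψ‖_∞ ≤ ‖ω‖₁/(2α)` + AM–GM with `∫e^{−y²/2} = ∫y²e^{−y²/2} = √(2π)`); hence the crux with
  any prescribed rate `c > √(π/2) ≈ 1.2533` is FALSE (`not_burgersLayerKHWithRate_of_gt`), while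
  `BurgersLayerKH ↔ ∃ c > 0, BurgersLayerKHWithRate c`. In Beronov–Kida units: growth `≤ R − α²`.
  Expected truth: `c₀ ≈ 0.2` (free-shear-layer KH value); Høiland's `½max|U'|` would give `½`.
-/

set_option linter.dupNamespace false

noncomputable section

open Filter Set MeasureTheory Topology intervalIntegral Complex

namespace Summit.AnomalousDissipation.AnomalousDissipation.Cruxes.BurgersLayerKH.Disproof

open Summit.AnomalousDissipation.AnomalousDissipation.Theses.MarginalStabilityChain

/-! ## §0 Engine: the Weber energy lemma (forced and unforced), the Green's-function sup bound,
and the growth-rate ceiling for Gaussian-class modes -/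


/-- An integrable function takes arbitrarily small absolute values beyond any threshold. [folklore] -/
theorem exists_ge_abs_le {g : ℝ → ℝ} (hg : Integrable g) {ε : ℝ} (hε : 0 < ε) (R : ℝ) :
    ∃ t, R ≤ t ∧ |g t| ≤ ε := by
  by_contra h
  push Not at h
  have hmono : IntegrableOn (fun _ : ℝ => ε) (Ici R) volume := by
    refine Integrable.mono' (hg.integrableOn (s := Ici R)).norm (by fun_prop) ?_
    refine ae_restrict_of_forall_mem measurableSet_Ici fun x hx => ?_
    rw [Real.norm_eq_abs, abs_of_pos hε, Real.norm_eq_abs]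
    exact (h x hx).le
  have := (integrableOn_const_iff (C := ε) (s := Ici R) (μ := volume)).1 hmono
  rcases this with h0 | hfin
  · exact hε.ne' (by simpa using h0)
  · simp [Real.volume_Ici] at hfin

/-- The same beyond any threshold towards `−∞`. [folklore] -/
theorem exists_le_abs_le {g : ℝ → ℝ} (hg : Integrable g) {ε : ℝ} (hε : 0 < ε) (R : ℝ) :
    ∃ s, s ≤ R ∧ |g s| ≤ ε := by
  obtain ⟨t, ht, hgt⟩ := exists_ge_abs_le (g := fun y => g (-y)) hg.comp_neg hε (-R)
  exact ⟨-t, by linarith, by simpa using hgt⟩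

/-- Uniform tails: the interval integrals of an integrable function over `[s, t]`, `s ≤ −R`, `t ≥ R`,
are `ε`-close to the full integral for `R` large. [folklore] -/
theorem tail_uniform {h : ℝ → ℝ} (hh : Integrable h) {ε : ℝ} (hε : 0 < ε) :
    ∃ R, ∀ s t, s ≤ -R → R ≤ t → |(∫ y in s..t, h y) - ∫ y, h y| ≤ ε := by
  have hT : Tendsto (fun p : ℝ × ℝ => ∫ y in p.1..p.2, h y) (atBot ×ˢ atTop) (𝓝 (∫ y, h y)) :=
    intervalIntegral_tendsto_integral hh tendsto_fst tendsto_snd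
  have hev := (Metric.tendsto_nhds.1 hT) ε hε
  obtain ⟨pa, hpa, pb, hpb, hboth⟩ := Filter.eventually_prod_iff.1 hev
  obtain ⟨R₁, hR₁⟩ := eventually_atBot.1 hpa
  obtain ⟨R₂, hR₂⟩ := eventually_atTop.1 hpb
  refine ⟨max (-R₁) R₂, fun s t hs ht => ?_⟩
  have h1 : pa s := hR₁ s (by linarith [le_max_left (-R₁) R₂])
  have h2 : pb t := hR₂ t (le_trans (le_max_right _ _) ht)
  have := hboth h1 h2
  rw [Real.dist_eq] at this
  exact this.le

/-- FTC for a `C¹`-type pair: `∫ₛᵗ f' = f t − f s` when `f'` is continuous. [folklore] -/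
theorem ftc {f f' : ℝ → ℝ} (hf : ∀ y, HasDerivAt f (f' y) y) (hc : Continuous f') (s t : ℝ) :
    ∫ y in s..t, f' y = f t - f s :=
  integral_eq_sub_of_hasDerivAt (fun y _ => hf y) (hc.intervalIntegrable _ _)

/-- Boundary control: if `0 ≤ n ≤ B` and `n' = 2F`, then `F` takes values `≤ ε` beyond every
threshold to the right and values `≥ −ε` beyond every threshold to the left (a bounded function
cannot have derivative bounded away from zero on a half-line). [folklore] -/
theorem boundary_control {n F : ℝ → ℝ} {B : ℝ} (hnd : ∀ y, HasDerivAt n (2 * F y) y)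
    (hn0 : ∀ y, 0 ≤ n y) (hBn : ∀ y, n y ≤ B) {ε : ℝ} (hε : 0 < ε) (R : ℝ) :
    (∃ t, R ≤ t ∧ F t ≤ ε) ∧ (∃ s, s ≤ R ∧ -ε ≤ F s) := by
  have hB0 : 0 ≤ B := (hn0 0).trans (hBn 0)
  have cn : Continuous n := continuous_iff_continuousAt.2 fun y => (hnd y).continuousAt
  constructor
  · by_contra hcon
    push Not at hcon
    set T := R + (B / (2 * ε) + 1) with hT
    have hpos : 0 < B / (2 * ε) + 1 := by positivity
    have hRT : R < T := by linarith
    obtain ⟨ξ, hξ, hslope⟩ :=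
      exists_hasDerivAt_eq_slope n (fun y => 2 * F y) hRT cn.continuousOn (fun y _ => hnd y)
    have hξF : ε < F ξ := hcon ξ hξ.1.le
    have hTR : 0 < T - R := by linarith
    have hnum : n T - n R = 2 * F ξ * (T - R) := by
      have hne : T - R ≠ 0 := hTR.ne'
      field_simp at hslope
      linarith [hslope]
    have h1 : n T - n R ≤ B := by linarith [hBn T, hn0 R]
    have h2 : 2 * ε * (T - R) < 2 * F ξ * (T - R) := by
      apply mul_lt_mul_of_pos_right _ hTR
      linarith
    have h3 : 2 * ε * (T - R) = B + 2 * ε := by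
      rw [hT]; field_simp; ring
    linarith
  · by_contra hcon
    push Not at hcon
    set S := R - (B / (2 * ε) + 1) with hS
    have hpos : 0 < B / (2 * ε) + 1 := by positivity
    have hSR : S < R := by linarith
    obtain ⟨ξ, hξ, hslope⟩ :=
      exists_hasDerivAt_eq_slope n (fun y => 2 * F y) hSR cn.continuousOn (fun y _ => hnd y)
    have hξF : F ξ < -ε := hcon ξ hξ.2.le
    have hRS : 0 < R - S := by linarith
    have hnum : n R - n S = 2 * F ξ * (R - S) := by
      have hne : R - S ≠ 0 := hRS.ne'
      field_simp at hslope
      linarith [hslope]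
    have h1 : -B ≤ n R - n S := by linarith [hBn S, hn0 R]
    have h2 : 2 * F ξ * (R - S) < 2 * (-ε) * (R - S) := by
      apply mul_lt_mul_of_pos_right _ hRS
      linarith
    have h3 : 2 * (-ε) * (R - S) = -(B + 2 * ε) := by
      rw [hS]; field_simp; ring
    linarith

/-- The bump `y ↦ max(c − y²/4, 0)` is continuous. [folklore] -/
theorem continuous_bump (c : ℝ) : Continuous fun y : ℝ => max (c - y ^ 2 / 4) 0 := by
  fun_prop

/-- The bump `y ↦ max(c − y²/4, 0)` has compact support (it vanishes for `|y| > 2√(max c 0)`).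
[folklore] -/
theorem hasCompactSupport_bump (c : ℝ) : HasCompactSupport fun y : ℝ => max (c - y ^ 2 / 4) 0 := by
  set Y : ℝ := 2 * Real.sqrt (max c 0) with hY
  have hY0 : 0 ≤ Y := by positivity
  have hzero : ∀ y : ℝ, Y < |y| → max (c - y ^ 2 / 4) 0 = 0 := by
    intro y hy
    have h1 : Y ^ 2 < y ^ 2 := by
      calc Y ^ 2 < |y| ^ 2 := by gcongr
        _ = y ^ 2 := sq_abs y
    have h2 : Y ^ 2 = 4 * max c 0 := by
      rw [hY, mul_pow, Real.sq_sqrt (le_max_right _ _)]; ring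
    have h3 : c ≤ max c 0 := le_max_left _ _
    exact max_eq_right (by nlinarith)
  refine HasCompactSupport.intro (isCompact_Icc : IsCompact (Icc (-Y) Y)) fun y hy => ?_
  apply hzero
  simp only [mem_Icc, not_and_or, not_le] at hy
  rcases hy with h | h
  · have : -y ≤ |y| := neg_le_abs y
    linarith
  · exact h.trans_le (le_abs_self y)

/-- Integrability bootstrap for the (forced) Weber energy lemma: under its hypotheses, `a² + b²`,
`a'² + b'²` and `y²(a² + b²)` are integrable on `ℝ`. [folklore] -/
theorem weber_integrable {a b a₁ b₁ a₂ b₂ r : ℝ → ℝ} {μ B : ℝ}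
    (ha : ∀ y, HasDerivAt a (a₁ y) y) (ha₁ : ∀ y, HasDerivAt a₁ (a₂ y) y)
    (hb : ∀ y, HasDerivAt b (b₁ y) y) (hb₁ : ∀ y, HasDerivAt b₁ (b₂ y) y)
    (hB : ∀ y, a y ^ 2 + b y ^ 2 ≤ B) (hrc : Continuous r) (hri : Integrable r)
    (heq : ∀ y, a₂ y * a y + b₂ y * b y = (y ^ 2 / 4 + μ) * (a y ^ 2 + b y ^ 2) + r y) :
    Integrable (fun y => a y ^ 2 + b y ^ 2) ∧ Integrable (fun y => a₁ y ^ 2 + b₁ y ^ 2) ∧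
      Integrable (fun y => y ^ 2 * (a y ^ 2 + b y ^ 2)) := by
  -- the players
  set n : ℝ → ℝ := fun y => a y ^ 2 + b y ^ 2 with hn_def
  set m : ℝ → ℝ := fun y => a₁ y ^ 2 + b₁ y ^ 2 with hm_def
  set F : ℝ → ℝ := fun y => a₁ y * a y + b₁ y * b y with hF_def
  set V : ℝ → ℝ := fun y => y ^ 2 / 4 + μ with hV_def
  have hBn : ∀ y, n y ≤ B := fun y => hB y
  have hn0 : ∀ y, 0 ≤ n y := fun y => by simp only [hn_def]; positivity
  have hm0 : ∀ y, 0 ≤ m y := fun y => by simp only [hm_def]; positivity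
  have hB0 : 0 ≤ B := (hn0 0).trans (hBn 0)
  -- continuity
  have ca : Continuous a := continuous_iff_continuousAt.2 fun y => (ha y).continuousAt
  have ca₁ : Continuous a₁ := continuous_iff_continuousAt.2 fun y => (ha₁ y).continuousAt
  have cb : Continuous b := continuous_iff_continuousAt.2 fun y => (hb y).continuousAt
  have cb₁ : Continuous b₁ := continuous_iff_continuousAt.2 fun y => (hb₁ y).continuousAt
  have cn : Continuous n := by simp only [hn_def]; fun_prop
  have cm : Continuous m := by simp only [hm_def]; fun_prop
  have cV : Continuous V := by simp only [hV_def]; fun_prop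
  -- derivatives of `n` and `F`
  have hnd : ∀ y, HasDerivAt n (2 * F y) y := by
    intro y
    have h := ((ha y).fun_mul (ha y)).fun_add ((hb y).fun_mul (hb y))
    have e : n = fun x => a x * a x + b x * b x := by funext x; simp only [hn_def]; ring
    rw [e]
    refine h.congr_deriv ?_
    simp only [hF_def]; ring
  have hFd : ∀ y, HasDerivAt F (m y + V y * n y + r y) y := by
    intro y
    have h := ((ha₁ y).fun_mul (ha y)).fun_add ((hb₁ y).fun_mul (hb y))
    rw [hF_def]
    refine h.congr_deriv ?_
    simp only [hm_def, hV_def, hn_def]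
    linear_combination heq y
  have iFTC : ∀ s t, ∫ y in s..t, (m y + V y * n y + r y) = F t - F s :=
    fun s t => ftc hFd (by fun_prop) s t
  -- `V = Vp - Vm`, `Vm` a compactly supported bump
  set Vp : ℝ → ℝ := fun y => max (V y) 0 with hVp_def
  set Vm : ℝ → ℝ := fun y => max (-μ - y ^ 2 / 4) 0 with hVm_def
  have hVp0 : ∀ y, 0 ≤ Vp y := fun y => le_max_right _ _
  have hVm0 : ∀ y, 0 ≤ Vm y := fun y => le_max_right _ _
  have hVpV : ∀ y, V y ≤ Vp y := fun y => le_max_left _ _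
  have hVsplit : ∀ y, V y = Vp y - Vm y := by
    intro y
    simp only [hVp_def, hVm_def, hV_def]
    rcases le_or_gt 0 (y ^ 2 / 4 + μ) with h | h
    · rw [max_eq_left h, max_eq_right (by linarith)]; ring
    · rw [max_eq_right h.le, max_eq_left (by linarith)]; ring
  have cVp : Continuous Vp := cV.max continuous_const
  have cVm : Continuous Vm := continuous_bump (-μ)
  have hVm_cs : HasCompactSupport Vm := hasCompactSupport_bump (-μ)
  have iVm : Integrable Vm := cVm.integrable_of_hasCompactSupport hVm_cs
  set P : ℝ → ℝ := fun y => m y + Vp y * n y with hP_def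
  have cP : Continuous P := by simp only [hP_def]; fun_prop
  have hP0 : ∀ y, 0 ≤ P y := fun y => by
    simp only [hP_def]; exact add_nonneg (hm0 y) (mul_nonneg (hVp0 y) (hn0 y))
  have hPle : ∀ y, P y ≤ (m y + V y * n y + r y) + (B * Vm y + |r y|) := by
    intro y
    simp only [hP_def]
    rw [hVsplit y]
    nlinarith [hVm0 y, hBn y, hn0 y, neg_abs_le (r y)]
  have iBVr : Integrable (fun y => B * Vm y + |r y|) := (iVm.const_mul B).add hri.abs
  set K : ℝ := 2 + ∫ y, (B * Vm y + |r y|) with hK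
  have hBVr0 : ∀ y, 0 ≤ B * Vm y + |r y| := fun y =>
    add_nonneg (mul_nonneg hB0 (hVm0 y)) (abs_nonneg _)
  have hbound : ∀ R, 0 ≤ R → ∫ y in (-R)..R, ‖P y‖ ≤ K := by
    intro R hR
    obtain ⟨⟨t, hRt, hFt⟩, -⟩ := boundary_control hnd hn0 hBn one_pos R
    obtain ⟨-, ⟨s, hsR, hFs⟩⟩ := boundary_control hnd hn0 hBn one_pos (-R)
    have hst : s ≤ t := by linarith
    have e1 : ∫ y in (-R)..R, ‖P y‖ = ∫ y in (-R)..R, P y :=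
      integral_congr fun y _ => Real.norm_of_nonneg (hP0 y)
    rw [e1]
    have h1 : ∫ y in (-R)..R, P y ≤ ∫ y in s..t, P y := by
      apply integral_mono_interval hsR (by linarith) hRt
      · exact Eventually.of_forall fun y => hP0 y
      · exact cP.intervalIntegrable _ _
    have h2 : ∫ y in s..t, P y ≤ ∫ y in s..t, ((m y + V y * n y + r y) + (B * Vm y + |r y|)) :=
      integral_mono_on hst (cP.intervalIntegrable _ _)
        ((by fun_prop : Continuous fun y => (m y + V y * n y + r y) + (B * Vm y + |r y|)).intervalIntegrable _ _)
        fun y _ => hPle y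
    have h3 : ∫ y in s..t, ((m y + V y * n y + r y) + (B * Vm y + |r y|))
        = (F t - F s) + ∫ y in s..t, (B * Vm y + |r y|) := by
      rw [integral_add ((by fun_prop : Continuous fun y => m y + V y * n y + r y).intervalIntegrable _ _)
        ((by fun_prop : Continuous fun y => B * Vm y + |r y|).intervalIntegrable _ _), iFTC]
    have h4 : ∫ y in s..t, (B * Vm y + |r y|) ≤ ∫ y, (B * Vm y + |r y|) := by
      rw [integral_of_le hst]
      exact setIntegral_le_integral iBVr (Eventually.of_forall hBVr0)
    linarith only [h1, h2, h3, h4, hFt, hFs, hK]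
  have iP : Integrable P := by
    refine integrable_of_intervalIntegral_norm_bounded K (a := fun R : ℝ => -R) (b := id) (l := atTop)
      (fun R => (cP.integrableOn_Icc).mono_set Ioc_subset_Icc_self) tendsto_neg_atTop_atBot tendsto_id ?_
    filter_upwards [eventually_ge_atTop 0] with R hR using hbound R hR
  have im : Integrable m := iP.mono' cm.aestronglyMeasurable (Eventually.of_forall fun y => by
    rw [Real.norm_of_nonneg (hm0 y)]; simp only [hP_def]
    exact le_add_of_nonneg_right (mul_nonneg (hVp0 y) (hn0 y)))
  have iVpn : Integrable (fun y => Vp y * n y) :=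
    iP.mono' (cVp.mul cn).aestronglyMeasurable (Eventually.of_forall fun y => by
      rw [Real.norm_of_nonneg (mul_nonneg (hVp0 y) (hn0 y))]; simp only [hP_def]
      exact le_add_of_nonneg_left (hm0 y))
  have iVmn : Integrable (fun y => Vm y * n y) :=
    (cVm.mul cn).integrable_of_hasCompactSupport hVm_cs.mul_right
  have iVn : Integrable (fun y => V y * n y) := by
    refine (iVpn.sub iVmn).congr (Eventually.of_forall fun y => ?_)
    simp only [Pi.sub_apply]
    rw [hVsplit y]; ring
  -- a compactly supported continuous `ρ ≥ 1 - V`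
  set ρ : ℝ → ℝ := fun y => max ((1 - μ) - y ^ 2 / 4) 0 with hρ_def
  have cρ : Continuous ρ := continuous_bump (1 - μ)
  have hρ_cs : HasCompactSupport ρ := hasCompactSupport_bump (1 - μ)
  have iρn : Integrable (fun y => ρ y * n y) :=
    (cρ.mul cn).integrable_of_hasCompactSupport hρ_cs.mul_right
  have inn : Integrable n := by
    refine (iVpn.add iρn).mono' cn.aestronglyMeasurable (Eventually.of_forall fun y => ?_)
    rw [Real.norm_of_nonneg (hn0 y)]
    simp only [Pi.add_apply]
    have h1 : 1 ≤ Vp y + ρ y := by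
      have e1 := hVpV y
      have e2 : (1 - μ) - y ^ 2 / 4 ≤ ρ y := le_max_left _ _
      simp only [hV_def] at e1
      linarith
    nlinarith [hn0 y]
  have iy2n : Integrable (fun y => y ^ 2 * n y) := by
    refine ((iVn.sub (inn.const_mul μ)).const_mul 4).congr (Eventually.of_forall fun y => ?_)
    simp only [Pi.sub_apply, hV_def]; ring
  exact ⟨inn, im, iy2n⟩

/-- **Weber energy inequality (forced).** If `a, b : ℝ → ℝ` are twice differentiable, `a² + b²`
is bounded, `r` is continuous and integrable, and `a'' a + b'' b = (y²/4 + μ)(a² + b²) + r`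
pointwise, then `(μ + ½) ∫ (a² + b²) ≤ −∫ r`. (Real and imaginary parts of a bounded solution of
`W'' = (y²/4 + μ + iν(y))W + f`, `r = re (f W̄)`; the proof is the energy identity
`∫ (|W'|² + (y²/4 + μ)|W|² + r) = 0` — boundary terms vanish along suitable sequences — combined
with the Hermite ground-state bound `∫ |W'|² + (y²/4)|W|² ≥ ½ ∫ |W|²`.) [folklore] -/
theorem weber_energy_forced {a b a₁ b₁ a₂ b₂ r : ℝ → ℝ} {μ B : ℝ}
    (ha : ∀ y, HasDerivAt a (a₁ y) y) (ha₁ : ∀ y, HasDerivAt a₁ (a₂ y) y)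
    (hb : ∀ y, HasDerivAt b (b₁ y) y) (hb₁ : ∀ y, HasDerivAt b₁ (b₂ y) y)
    (hB : ∀ y, a y ^ 2 + b y ^ 2 ≤ B) (hrc : Continuous r) (hri : Integrable r)
    (heq : ∀ y, a₂ y * a y + b₂ y * b y = (y ^ 2 / 4 + μ) * (a y ^ 2 + b y ^ 2) + r y) :
    (μ + 1 / 2) * ∫ y, (a y ^ 2 + b y ^ 2) ≤ -∫ y, r y := by
  obtain ⟨inn, im, iy2n⟩ := weber_integrable ha ha₁ hb hb₁ hB hrc hri heq
  -- the players
  set n : ℝ → ℝ := fun y => a y ^ 2 + b y ^ 2 with hn_def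
  set m : ℝ → ℝ := fun y => a₁ y ^ 2 + b₁ y ^ 2 with hm_def
  set F : ℝ → ℝ := fun y => a₁ y * a y + b₁ y * b y with hF_def
  set V : ℝ → ℝ := fun y => y ^ 2 / 4 + μ with hV_def
  have hn0 : ∀ y, 0 ≤ n y := fun y => by simp only [hn_def]; positivity
  have hm0 : ∀ y, 0 ≤ m y := fun y => by simp only [hm_def]; positivity
  -- continuity
  have ca : Continuous a := continuous_iff_continuousAt.2 fun y => (ha y).continuousAt
  have ca₁ : Continuous a₁ := continuous_iff_continuousAt.2 fun y => (ha₁ y).continuousAt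
  have cb : Continuous b := continuous_iff_continuousAt.2 fun y => (hb y).continuousAt
  have cb₁ : Continuous b₁ := continuous_iff_continuousAt.2 fun y => (hb₁ y).continuousAt
  have cn : Continuous n := by simp only [hn_def]; fun_prop
  have cm : Continuous m := by simp only [hm_def]; fun_prop
  have cF : Continuous F := by simp only [hF_def]; fun_prop
  have cV : Continuous V := by simp only [hV_def]; fun_prop
  -- derivatives of `n` and `F`
  have hnd : ∀ y, HasDerivAt n (2 * F y) y := by
    intro y
    have h := ((ha y).fun_mul (ha y)).fun_add ((hb y).fun_mul (hb y))
    have e : n = fun x => a x * a x + b x * b x := by funext x; simp only [hn_def]; ring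
    rw [e]
    refine h.congr_deriv ?_
    simp only [hF_def]; ring
  have hFd : ∀ y, HasDerivAt F (m y + V y * n y + r y) y := by
    intro y
    have h := ((ha₁ y).fun_mul (ha y)).fun_add ((hb₁ y).fun_mul (hb y))
    rw [hF_def]
    refine h.congr_deriv ?_
    simp only [hm_def, hV_def, hn_def]
    linear_combination heq y
  have iFTC : ∀ s t, ∫ y in s..t, (m y + V y * n y + r y) = F t - F s :=
    fun s t => ftc hFd (by fun_prop) s t
  -- integrability of everything in sight
  have iVn : Integrable (fun y => V y * n y) := by
    refine ((iy2n.div_const 4).add (inn.const_mul μ)).congr (Eventually.of_forall fun y => ?_)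
    simp only [Pi.add_apply, hV_def]; ring
  have iy2n' : Integrable (fun y => y ^ 2 / 4 * n y) := by
    refine (iy2n.div_const 4).congr (Eventually.of_forall fun y => ?_)
    simp only; ring
  have hFabs : ∀ y, |F y| ≤ (m y + n y) / 2 := by
    intro y
    simp only [hF_def, hm_def, hn_def]
    rw [abs_le]
    constructor
    · nlinarith [sq_nonneg (a₁ y + a y), sq_nonneg (b₁ y + b y)]
    · nlinarith [sq_nonneg (a₁ y - a y), sq_nonneg (b₁ y - b y)]
  have iF : Integrable F := by
    refine ((im.add inn).div_const 2).mono' cF.aestronglyMeasurable (Eventually.of_forall fun y => ?_)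
    rw [Real.norm_eq_abs]
    simpa using hFabs y
  have iG : Integrable (fun y => |F y| + y ^ 2 * n y) := iF.abs.add iy2n
  have iH : Integrable (fun y => m y + y ^ 2 / 4 * n y) := im.add iy2n'
  have iMV : Integrable (fun y => m y + V y * n y + r y) := (im.add iVn).add hri
  -- Step C: points where both boundary quantities are small
  have ptTop : ∀ ε, 0 < ε → ∀ R, ∃ t, R ≤ t ∧ 1 ≤ t ∧ |F t| ≤ ε ∧ t * n t ≤ ε := by
    intro ε hε R
    obtain ⟨t, ht, hG⟩ := exists_ge_abs_le iG hε (max R 1)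
    have hR : R ≤ t := le_trans (le_max_left _ _) ht
    have h1 : 1 ≤ t := le_trans (le_max_right _ _) ht
    have hG' : |F t| + t ^ 2 * n t ≤ ε := by
      have := (abs_le.1 hG).2
      simpa using this
    have hnt := hn0 t
    have hFt := abs_nonneg (F t)
    have key : 0 ≤ t * (t - 1) * n t := mul_nonneg (mul_nonneg (by linarith) (by linarith)) hnt
    refine ⟨t, hR, h1, ?_, ?_⟩
    · nlinarith only [hG', hnt, hFt, h1]
    · linarith only [hG', hFt, key]
  have ptBot : ∀ ε, 0 < ε → ∀ R, ∃ s, s ≤ R ∧ s ≤ -1 ∧ |F s| ≤ ε ∧ -s * n s ≤ ε := by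
    intro ε hε R
    obtain ⟨s, hs, hG⟩ := exists_le_abs_le iG hε (min R (-1))
    have hR : s ≤ R := le_trans hs (min_le_left _ _)
    have h1 : s ≤ -1 := le_trans hs (min_le_right _ _)
    have hG' : |F s| + s ^ 2 * n s ≤ ε := by
      have := (abs_le.1 hG).2
      simpa using this
    have hns := hn0 s
    have hFs := abs_nonneg (F s)
    have key : 0 ≤ (-s) * (-s - 1) * n s := mul_nonneg (mul_nonneg (by linarith) (by linarith)) hns
    refine ⟨s, hR, h1, ?_, ?_⟩
    · nlinarith only [hG', hns, hFs, h1]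
    · linarith only [hG', hFs, key]
  -- Step D: the limiting identities
  set I₁ : ℝ := ∫ y, (m y + V y * n y + r y) with hI₁
  set Ir : ℝ := ∫ y, r y with hIr
  set I₂ : ℝ := ∫ y, n y with hI₂
  set I₃ : ℝ := ∫ y, (m y + y ^ 2 / 4 * n y) with hI₃
  have hI₁0 : I₁ = 0 := by
    have key : ∀ ε, 0 < ε → |I₁| ≤ 3 * ε := by
      intro ε hε
      obtain ⟨R, hR⟩ := tail_uniform iMV hε
      obtain ⟨t, hRt, -, hFt, -⟩ := ptTop ε hε R
      obtain ⟨s, hsR, -, hFs, -⟩ := ptBot ε hε (-R)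
      have hint := hR s t hsR hRt
      rw [iFTC s t] at hint
      have e1 := abs_le.1 hint
      have e2 := abs_le.1 hFt
      have e3 := abs_le.1 hFs
      rw [abs_le]; constructor <;> linarith only [e1.1, e1.2, e2.1, e2.2, e3.1, e3.2]
    by_contra hne
    have hpos : 0 < |I₁| := abs_pos.2 hne
    have := key (|I₁| / 6) (by positivity)
    linarith only [this, hpos]
  have hI₂I₃ : I₂ / 2 ≤ I₃ := by
    apply le_of_forall_pos_le_add
    intro ε' hε'
    set ε : ℝ := ε' / 3 with hεdef
    have hε : 0 < ε := by positivity
    obtain ⟨R₃, hR₃⟩ := tail_uniform iH hε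
    obtain ⟨R₂, hR₂⟩ := tail_uniform inn hε
    obtain ⟨t, hRt, h1t, -, hnt⟩ := ptTop ε hε (max R₃ R₂)
    obtain ⟨s, hsR, hs1, -, hns⟩ := ptBot ε hε (-max R₃ R₂)
    have hst : s ≤ t := by linarith only [hRt, hsR, h1t, hs1]
    -- integration by parts of `y F = (y/2) n'`
    set φ : ℝ → ℝ := fun y => y / 2 * n y with hφ_def
    have hφd : ∀ y, HasDerivAt φ (n y / 2 + y * F y) y := by
      intro y
      have h := ((hasDerivAt_id' y).div_const 2).fun_mul (hnd y)
      rw [hφ_def]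
      refine h.congr_deriv ?_
      ring
    have iparts : ∫ y in s..t, (n y / 2 + y * F y) = φ t - φ s := ftc hφd (by fun_prop) s t
    have hpt : ∀ y, n y / 2 - (n y / 2 + y * F y) ≤ m y + y ^ 2 / 4 * n y := by
      intro y
      simp only [hn_def, hm_def, hF_def]
      nlinarith [sq_nonneg (a₁ y + y / 2 * a y), sq_nonneg (b₁ y + y / 2 * b y)]
    have h1 : ∫ y in s..t, (n y / 2 - (n y / 2 + y * F y)) ≤ ∫ y in s..t, (m y + y ^ 2 / 4 * n y) :=
      integral_mono_on hst
        ((by fun_prop : Continuous fun y => n y / 2 - (n y / 2 + y * F y)).intervalIntegrable _ _)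
        ((by fun_prop : Continuous fun y => m y + y ^ 2 / 4 * n y).intervalIntegrable _ _)
        fun y _ => hpt y
    have h2 : ∫ y in s..t, (n y / 2 - (n y / 2 + y * F y))
        = (∫ y in s..t, n y) / 2 - (φ t - φ s) := by
      rw [integral_sub ((by fun_prop : Continuous fun y => n y / 2).intervalIntegrable _ _)
        ((by fun_prop : Continuous fun y => n y / 2 + y * F y).intervalIntegrable _ _), iparts,
        intervalIntegral.integral_div]
    have hφt : φ t ≤ ε / 2 := by
      have e : φ t = (t * n t) / 2 := by simp only [hφ_def]; ring
      rw [e]; linarith only [hnt]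
    have hφs : -(ε / 2) ≤ φ s := by
      have e : φ s = -((-s * n s) / 2) := by simp only [hφ_def]; ring
      rw [e]; linarith only [hns]
    have e3 := abs_le.1 (hR₃ s t (by linarith only [hsR, le_max_left R₃ R₂])
      (le_trans (le_max_left _ _) hRt))
    have e2 := abs_le.1 (hR₂ s t (by linarith only [hsR, le_max_right R₃ R₂])
      (le_trans (le_max_right _ _) hRt))
    have hfin : I₂ / 2 ≤ I₃ + 5 * ε / 2 := by
      linarith only [h1, h2, hφt, hφs, e3.1, e3.2, e2.1, e2.2]
    have : 5 * ε / 2 ≤ ε' := by rw [hεdef]; linarith only [hε']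
    linarith only [hfin, this]
  have hI₁split : I₁ = I₃ + μ * I₂ + Ir := by
    have e1 : ∫ y, (m y + V y * n y + r y) = (∫ y, (m y + V y * n y)) + ∫ y, r y :=
      integral_add (im.add iVn) hri
    have e2 : ∫ y, (m y + V y * n y) = (∫ y, (m y + y ^ 2 / 4 * n y)) + μ * ∫ y, n y := by
      rw [← MeasureTheory.integral_const_mul, ← integral_add iH (inn.const_mul μ)]
      exact integral_congr_ae (Eventually.of_forall fun y => by simp only [hV_def]; ring)
    simp only [hI₁, hI₂, hI₃, hIr]
    rw [e1, e2]
  have h5 : (μ + 1 / 2) * I₂ ≤ -Ir := by linarith only [hI₁0, hI₁split, hI₂I₃]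
  simpa only [hI₂, hIr, hn_def] using h5

/-- **Weber energy lemma.** If `a, b : ℝ → ℝ` are twice differentiable, `a² + b²` is bounded, and
`a'' a + b'' b = (y²/4 + μ)(a² + b²)` pointwise with `μ > −1/2`, then `a ≡ b ≡ 0` (the unforced
case of `weber_energy_forced`: `(μ + ½)∫(a² + b²) ≤ 0`). [folklore] -/
theorem weber_energy {a b a₁ b₁ a₂ b₂ : ℝ → ℝ} {μ B : ℝ}
    (ha : ∀ y, HasDerivAt a (a₁ y) y) (ha₁ : ∀ y, HasDerivAt a₁ (a₂ y) y)
    (hb : ∀ y, HasDerivAt b (b₁ y) y) (hb₁ : ∀ y, HasDerivAt b₁ (b₂ y) y)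
    (hB : ∀ y, a y ^ 2 + b y ^ 2 ≤ B)
    (heq : ∀ y, a₂ y * a y + b₂ y * b y = (y ^ 2 / 4 + μ) * (a y ^ 2 + b y ^ 2))
    (hμ : -1 / 2 < μ) (y₀ : ℝ) : a y₀ = 0 ∧ b y₀ = 0 := by
  have heq' : ∀ y, a₂ y * a y + b₂ y * b y
      = (y ^ 2 / 4 + μ) * (a y ^ 2 + b y ^ 2) + (fun _ => (0:ℝ)) y :=
    fun y => by simp only [heq y, add_zero]
  obtain ⟨inn, -, -⟩ :=
    weber_integrable ha ha₁ hb hb₁ hB continuous_const (integrable_zero _ _ _) heq'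
  have h := weber_energy_forced ha ha₁ hb hb₁ hB continuous_const (integrable_zero _ _ _) heq'
  have e0 : (∫ _y : ℝ, (0 : ℝ)) = 0 := by simp
  have h' : (μ + 1 / 2) * ∫ y, (a y ^ 2 + b y ^ 2) ≤ 0 := by
    calc (μ + 1 / 2) * ∫ y, (a y ^ 2 + b y ^ 2) ≤ -∫ _y : ℝ, (0 : ℝ) := h
      _ = 0 := by rw [e0, neg_zero]
  have hn0 : ∀ y, 0 ≤ a y ^ 2 + b y ^ 2 := fun y => by positivity
  have hI0 : 0 ≤ ∫ y, (a y ^ 2 + b y ^ 2) := integral_nonneg hn0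
  have hI : ∫ y, (a y ^ 2 + b y ^ 2) = 0 := by
    by_contra hne
    have hpos : 0 < ∫ y, (a y ^ 2 + b y ^ 2) := lt_of_le_of_ne hI0 (Ne.symm hne)
    have : 0 < (μ + 1 / 2) * ∫ y, (a y ^ 2 + b y ^ 2) := mul_pos (by linarith) hpos
    linarith
  have ca : Continuous a := continuous_iff_continuousAt.2 fun y => (ha y).continuousAt
  have cb : Continuous b := continuous_iff_continuousAt.2 fun y => (hb y).continuousAt
  have cn : Continuous fun y => a y ^ 2 + b y ^ 2 := by fun_prop
  have hn_ae := (integral_eq_zero_iff_of_nonneg hn0 inn).1 hI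
  have hn_zero := (cn.ae_eq_iff_eq volume continuous_const).1 hn_ae
  have hy : a y₀ ^ 2 + b y₀ ^ 2 = 0 := congrFun hn_zero y₀
  have ha2 : a y₀ ^ 2 = 0 := by nlinarith only [hy, sq_nonneg (a y₀), sq_nonneg (b y₀)]
  have hb2 : b y₀ ^ 2 = 0 := by nlinarith only [hy, sq_nonneg (a y₀), sq_nonneg (b y₀)]
  exact ⟨pow_eq_zero_iff two_ne_zero |>.1 ha2, pow_eq_zero_iff two_ne_zero |>.1 hb2⟩

/-- **Weber energy inequality, complex forced form.** A bounded, twice differentiable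
`W : ℝ → ℂ` with `W'' = (y²/4 + μ + iν(y)) W + f`, `μ` real, `ν` real-valued, `f` continuous with
`‖f‖‖W‖` integrable, has `‖W‖²` integrable and satisfies `(μ + ½) ∫ ‖W‖² ≤ ∫ ‖f‖ ‖W‖`. [folklore] -/
theorem weber_complex_forced {W W₁ W₂ f : ℝ → ℂ} {μ C : ℝ} (ν : ℝ → ℝ)
    (hW : ∀ y, HasDerivAt W (W₁ y) y) (hW₁ : ∀ y, HasDerivAt W₁ (W₂ y) y)
    (hC : ∀ y, ‖W y‖ ≤ C) (hfc : Continuous f) (hfi : Integrable fun y => ‖f y‖ * ‖W y‖)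
    (heq : ∀ y, W₂ y = ((y : ℂ) ^ 2 / 4 + (μ : ℂ) + Complex.I * (ν y : ℂ)) * W y + f y) :
    Integrable (fun y => ‖W y‖ ^ 2) ∧ (μ + 1 / 2) * ∫ y, ‖W y‖ ^ 2 ≤ ∫ y, ‖f y‖ * ‖W y‖ := by
  have ha : ∀ y, HasDerivAt (fun y => (W y).re) ((W₁ y).re) y := fun y => by
    simpa [Function.comp_def] using Complex.reCLM.hasFDerivAt.comp_hasDerivAt y (hW y)
  have ha₁ : ∀ y, HasDerivAt (fun y => (W₁ y).re) ((W₂ y).re) y := fun y => by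
    simpa [Function.comp_def] using Complex.reCLM.hasFDerivAt.comp_hasDerivAt y (hW₁ y)
  have hb : ∀ y, HasDerivAt (fun y => (W y).im) ((W₁ y).im) y := fun y => by
    simpa [Function.comp_def] using Complex.imCLM.hasFDerivAt.comp_hasDerivAt y (hW y)
  have hb₁ : ∀ y, HasDerivAt (fun y => (W₁ y).im) ((W₂ y).im) y := fun y => by
    simpa [Function.comp_def] using Complex.imCLM.hasFDerivAt.comp_hasDerivAt y (hW₁ y)
  have hnorm : ∀ y, (W y).re ^ 2 + (W y).im ^ 2 = ‖W y‖ ^ 2 := fun y => by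
    rw [← Complex.normSq_eq_norm_sq, Complex.normSq_apply]; ring
  have hB : ∀ y, (W y).re ^ 2 + (W y).im ^ 2 ≤ C ^ 2 := by
    intro y
    rw [hnorm]
    exact pow_le_pow_left₀ (norm_nonneg _) (hC y) 2
  have cW : Continuous W := continuous_iff_continuousAt.2 fun y => (hW y).continuousAt
  -- the real forcing r = re (f W̄)
  set r : ℝ → ℝ := fun y => (f y * (starRingEnd ℂ) (W y)).re with hr_def
  have hrc : Continuous r := by simp only [hr_def]; fun_prop
  have hrle : ∀ y, |r y| ≤ ‖f y‖ * ‖W y‖ := fun y => by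
    simp only [hr_def]
    calc |(f y * (starRingEnd ℂ) (W y)).re| ≤ ‖f y * (starRingEnd ℂ) (W y)‖ := Complex.abs_re_le_norm _
      _ = ‖f y‖ * ‖W y‖ := by rw [norm_mul, Complex.norm_conj]
  have hri : Integrable r := hfi.mono' hrc.aestronglyMeasurable
    (Eventually.of_forall fun y => by rw [Real.norm_eq_abs]; exact hrle y)
  have heq' : ∀ y, (W₂ y).re * (W y).re + (W₂ y).im * (W y).im
      = (y ^ 2 / 4 + μ) * ((W y).re ^ 2 + (W y).im ^ 2) + r y := by
    intro y
    have e : W₂ y = (((y ^ 2 / 4 + μ : ℝ) : ℂ) + Complex.I * (ν y : ℂ)) * W y + f y := by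
      rw [heq y]; push_cast; ring
    rw [e]
    simp only [hr_def, Complex.mul_re, Complex.mul_im, Complex.add_re, Complex.add_im,
      Complex.ofReal_re, Complex.ofReal_im, Complex.I_re, Complex.I_im, Complex.conj_re,
      Complex.conj_im]
    ring
  have h := weber_energy_forced ha ha₁ hb hb₁ hB hrc hri heq'
  obtain ⟨inn, -, -⟩ := weber_integrable ha ha₁ hb hb₁ hB hrc hri heq'
  have e1 : ∫ y, ((W y).re ^ 2 + (W y).im ^ 2) = ∫ y, ‖W y‖ ^ 2 :=
    integral_congr_ae (Eventually.of_forall fun y => hnorm y)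
  rw [e1] at h
  have e2 : -∫ y, r y ≤ ∫ y, ‖f y‖ * ‖W y‖ := by
    rw [← MeasureTheory.integral_neg]
    exact integral_mono hri.neg hfi fun y => by
      have := hrle y; linarith [neg_abs_le (r y), this, abs_nonneg (r y), neg_le_abs (r y)]
  refine ⟨inn.congr (Eventually.of_forall fun y => hnorm y), h.trans e2⟩

/-- **Weber energy lemma, complex form.** A bounded `W : ℝ → ℂ`, twice differentiable, with
`W'' = (y²/4 + μ + iν(y)) W` for a real constant `μ > −1/2` and any real function `ν`, vanishes
identically. (Apply `weber_energy` to `a = re W`, `b = im W`: the `iν` terms cancel in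
`a'' a + b'' b`.) [folklore] -/
theorem weber_complex {W W₁ W₂ : ℝ → ℂ} {μ C : ℝ} (ν : ℝ → ℝ)
    (hW : ∀ y, HasDerivAt W (W₁ y) y) (hW₁ : ∀ y, HasDerivAt W₁ (W₂ y) y)
    (hC : ∀ y, ‖W y‖ ≤ C)
    (heq : ∀ y, W₂ y = ((y : ℂ) ^ 2 / 4 + (μ : ℂ) + Complex.I * (ν y : ℂ)) * W y)
    (hμ : -1 / 2 < μ) (y₀ : ℝ) : W y₀ = 0 := by
  have ha : ∀ y, HasDerivAt (fun y => (W y).re) ((W₁ y).re) y := fun y => by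
    simpa [Function.comp_def] using Complex.reCLM.hasFDerivAt.comp_hasDerivAt y (hW y)
  have ha₁ : ∀ y, HasDerivAt (fun y => (W₁ y).re) ((W₂ y).re) y := fun y => by
    simpa [Function.comp_def] using Complex.reCLM.hasFDerivAt.comp_hasDerivAt y (hW₁ y)
  have hb : ∀ y, HasDerivAt (fun y => (W y).im) ((W₁ y).im) y := fun y => by
    simpa [Function.comp_def] using Complex.imCLM.hasFDerivAt.comp_hasDerivAt y (hW y)
  have hb₁ : ∀ y, HasDerivAt (fun y => (W₁ y).im) ((W₂ y).im) y := fun y => by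
    simpa [Function.comp_def] using Complex.imCLM.hasFDerivAt.comp_hasDerivAt y (hW₁ y)
  have hB : ∀ y, (W y).re ^ 2 + (W y).im ^ 2 ≤ C ^ 2 := by
    intro y
    have h1 : (W y).re ^ 2 + (W y).im ^ 2 = ‖W y‖ ^ 2 := by
      rw [← Complex.normSq_eq_norm_sq, Complex.normSq_apply]; ring
    rw [h1]
    exact pow_le_pow_left₀ (norm_nonneg _) (hC y) 2
  have heq' : ∀ y, (W₂ y).re * (W y).re + (W₂ y).im * (W y).im
      = (y ^ 2 / 4 + μ) * ((W y).re ^ 2 + (W y).im ^ 2) := by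
    intro y
    have e : W₂ y = (((y ^ 2 / 4 + μ : ℝ) : ℂ) + Complex.I * (ν y : ℂ)) * W y := by
      rw [heq y]; push_cast; ring
    rw [e]
    simp only [Complex.mul_re, Complex.mul_im, Complex.add_re, Complex.add_im, Complex.ofReal_re,
      Complex.ofReal_im, Complex.I_re, Complex.I_im]
    ring
  obtain ⟨h1, h2⟩ := weber_energy ha ha₁ hb hb₁ hB heq' hμ y₀
  exact Complex.ext (by simpa using h1) (by simpa using h2)


/-- Gaussian domination of an exponentially tilted Gaussian: `e^{sαu} C e^{−u²/4} ≤ C e^{2α²} e^{−u²/8}`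
for `s = ±1`. [folklore] -/
theorem exp_tilt_le (α u C : ℝ) (hC : 0 ≤ C) (s : ℝ) (hs : s = 1 ∨ s = -1) :
    Real.exp (s * α * u) * (C * Real.exp (-(u ^ 2) / 4))
      ≤ C * Real.exp (2 * α ^ 2) * Real.exp (-(1 / 8) * u ^ 2) := by
  have key : s * α * u + -(u ^ 2) / 4 ≤ 2 * α ^ 2 + -(1 / 8) * u ^ 2 := by
    rcases hs with h | h <;> subst h <;> nlinarith [sq_nonneg (u + 4 * α), sq_nonneg (u - 4 * α)]
  calc Real.exp (s * α * u) * (C * Real.exp (-(u ^ 2) / 4))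
      = C * Real.exp (s * α * u + -(u ^ 2) / 4) := by rw [Real.exp_add]; ring
    _ ≤ C * Real.exp (2 * α ^ 2 + -(1 / 8) * u ^ 2) := by gcongr
    _ = C * Real.exp (2 * α ^ 2) * Real.exp (-(1 / 8) * u ^ 2) := by rw [Real.exp_add]; ring

/-- **Green's-function sup bound.** Let `α > 0` and let `ψ : ℝ → ℂ` be twice differentiable and
BOUNDED, with `w := ψ'' − α²ψ` continuous and Gaussian-dominated (`‖w‖ ≤ Ce^{−u²/4}`). Then
`‖ψ(y)‖ ≤ ‖w‖_{L¹} / (2α)` for every `y` — i.e. `ψ = −G_α ∗ w` with `G_α(y) = e^{−α|y|}/(2α)`,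
proved without writing the convolution: `χ = ψ' + αψ`, `ξ = ψ' − αψ` solve `χ' = αχ + w`,
`ξ' = −αξ + w`, their bounded particular solutions are `−e^{αy}∫_{u>y} e^{−αu}w`,
`e^{−αy}∫_{u≤y} e^{αu}w`, the homogeneous parts `c e^{αy}`, `c' e^{−αy}` are killed by boundedness,
and `2αψ = χ − ξ`. [folklore] -/
theorem green_sup_bound {α : ℝ} (hα : 0 < α) {ψ ψ₁ ψ₂ : ℝ → ℂ} {M C : ℝ}
    (hψ : ∀ y, HasDerivAt ψ (ψ₁ y) y) (hψ₁ : ∀ y, HasDerivAt ψ₁ (ψ₂ y) y)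
    (hM : ∀ y, ‖ψ y‖ ≤ M) (hwc : Continuous fun y => ψ₂ y - (α : ℂ) ^ 2 * ψ y)
    (hwd : ∀ y, ‖ψ₂ y - (α : ℂ) ^ 2 * ψ y‖ ≤ C * Real.exp (-(y ^ 2) / 4)) (y₀ : ℝ) :
    ‖ψ y₀‖ ≤ (∫ u, ‖ψ₂ u - (α : ℂ) ^ 2 * ψ u‖) / (2 * α) := by
  set w : ℝ → ℂ := fun y => ψ₂ y - (α : ℂ) ^ 2 * ψ y with hw_def
  change Continuous w at hwc
  change ∀ y, ‖w y‖ ≤ C * Real.exp (-(y ^ 2) / 4) at hwd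
  change ‖ψ y₀‖ ≤ (∫ u, ‖w u‖) / (2 * α)
  have hC0 : 0 ≤ C := by
    have := hwd 0
    simp only [ne_eq, OfNat.ofNat_ne_zero, not_false_eq_true, zero_pow, neg_zero, zero_div,
      Real.exp_zero, mul_one] at this
    exact (norm_nonneg _).trans this
  have hαC : (α : ℂ) ≠ 0 := Complex.ofReal_ne_zero.mpr hα.ne'
  -- integrability of `w` and of its exponential tilts
  have iGauss : Integrable fun u : ℝ => C * Real.exp (2 * α ^ 2) * Real.exp (-(1 / 8) * u ^ 2) :=
    (integrable_exp_neg_mul_sq (by norm_num : (0:ℝ) < 1 / 8)).const_mul _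
  set gm : ℝ → ℂ := fun u => Complex.exp (-(α : ℂ) * u) * w u with hgm_def
  set gp : ℝ → ℂ := fun u => Complex.exp ((α : ℂ) * u) * w u with hgp_def
  have cgm : Continuous gm := by simp only [hgm_def]; fun_prop
  have cgp : Continuous gp := by simp only [hgp_def]; fun_prop
  have nexp : ∀ (s u : ℝ), ‖Complex.exp ((s * α : ℝ) * (u : ℂ))‖ = Real.exp (s * α * u) := by
    intro s u
    rw [Complex.norm_exp]
    congr 1
    simp [Complex.mul_re]
  have igm : Integrable gm := by
    refine iGauss.mono' cgm.aestronglyMeasurable (Eventually.of_forall fun u => ?_)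
    simp only [hgm_def, norm_mul]
    have e : ‖Complex.exp (-(α : ℂ) * u)‖ = Real.exp ((-1) * α * u) := by
      rw [← nexp (-1) u]; push_cast; ring_nf
    rw [e]
    exact (mul_le_mul_of_nonneg_left (hwd u) (Real.exp_pos _).le).trans
      (exp_tilt_le α u C hC0 (-1) (Or.inr rfl))
  have igp : Integrable gp := by
    refine iGauss.mono' cgp.aestronglyMeasurable (Eventually.of_forall fun u => ?_)
    simp only [hgp_def, norm_mul]
    have e : ‖Complex.exp ((α : ℂ) * u)‖ = Real.exp (1 * α * u) := by
      rw [← nexp 1 u]; push_cast; ring_nf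
    rw [e]
    exact (mul_le_mul_of_nonneg_left (hwd u) (Real.exp_pos _).le).trans
      (exp_tilt_le α u C hC0 1 (Or.inl rfl))
  have iw : Integrable fun u => ‖w u‖ := by
    have : Integrable fun u : ℝ => C * Real.exp (-(1 / 4) * u ^ 2) :=
      (integrable_exp_neg_mul_sq (by norm_num : (0:ℝ) < 1 / 4)).const_mul _
    refine this.mono' hwc.norm.aestronglyMeasurable (Eventually.of_forall fun u => ?_)
    rw [norm_norm]
    convert hwd u using 2
    ring
  -- the particular solutions
  set Bm : ℝ → ℂ := fun y => ∫ u in Iic y, gm u with hBm_def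
  set Bp : ℝ → ℂ := fun y => ∫ u in Iic y, gp u with hBp_def
  have hBm : ∀ y, HasDerivAt Bm (gm y) y := by
    intro y
    have e : Bm = fun y => Bm 0 + ∫ u in (0:ℝ)..y, gm u := by
      funext y
      simp only [hBm_def]
      rw [← integral_Iic_sub_Iic igm.integrableOn igm.integrableOn]
      ring
    rw [e]
    exact ((cgm.integral_hasStrictDerivAt 0 y).hasDerivAt).const_add _
  have hBp : ∀ y, HasDerivAt Bp (gp y) y := by
    intro y
    have e : Bp = fun y => Bp 0 + ∫ u in (0:ℝ)..y, gp u := by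
      funext y
      simp only [hBp_def]
      rw [← integral_Iic_sub_Iic igp.integrableOn igp.integrableOn]
      ring
    rw [e]
    exact ((cgp.integral_hasStrictDerivAt 0 y).hasDerivAt).const_add _
  set Itot : ℂ := ∫ u, gm u with hItot
  set χ₀ : ℝ → ℂ := fun y => -Complex.exp ((α : ℂ) * y) * (Itot - Bm y) with hχ₀_def
  set ξ₀ : ℝ → ℂ := fun y => Complex.exp (-(α : ℂ) * y) * Bp y with hξ₀_def
  have hEp : ∀ y : ℝ, HasDerivAt (fun x : ℝ => Complex.exp ((α : ℂ) * x)) ((α : ℂ) * Complex.exp ((α : ℂ) * y)) y := by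
    intro y
    have h1 : HasDerivAt (fun x : ℝ => (α : ℂ) * x) (α : ℂ) y := by
      simpa using ((hasDerivAt_id y).ofReal_comp).const_mul (α : ℂ)
    simpa [mul_comm] using h1.cexp
  have hEm : ∀ y : ℝ, HasDerivAt (fun x : ℝ => Complex.exp (-(α : ℂ) * x)) (-(α : ℂ) * Complex.exp (-(α : ℂ) * y)) y := by
    intro y
    have h1 : HasDerivAt (fun x : ℝ => -(α : ℂ) * x) (-(α : ℂ)) y := by
      simpa using ((hasDerivAt_id y).ofReal_comp).const_mul (-(α : ℂ))
    simpa [mul_comm] using h1.cexp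
  have hee : ∀ y : ℝ, Complex.exp ((α : ℂ) * y) * Complex.exp (-(α : ℂ) * y) = 1 := by
    intro y; rw [← Complex.exp_add]; simp
  have hχ₀ : ∀ y, HasDerivAt χ₀ ((α : ℂ) * χ₀ y + w y) y := by
    intro y
    have h := ((hEp y).fun_neg).fun_mul ((hBm y).const_sub Itot)
    simp only [hχ₀_def]
    refine h.congr_deriv ?_
    simp only [hgm_def]
    linear_combination (w y) * hee y
  have hξ₀ : ∀ y, HasDerivAt ξ₀ (-(α : ℂ) * ξ₀ y + w y) y := by
    intro y
    have h := (hEm y).fun_mul (hBp y)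
    simp only [hξ₀_def]
    refine h.congr_deriv ?_
    simp only [hgp_def]
    linear_combination (w y) * hee y
  -- bounds on the particular solutions
  have hχ₀b : ∀ y, ‖χ₀ y‖ ≤ ∫ u in Ioi y, ‖w u‖ := by
    intro y
    have e1 : Itot - Bm y = ∫ u in Ioi y, gm u := by
      simp only [hItot, hBm_def]
      rw [← integral_Iic_add_Ioi igm.integrableOn igm.integrableOn]
      ring
    have e2 : ‖χ₀ y‖ = Real.exp (α * y) * ‖∫ u in Ioi y, gm u‖ := by
      simp only [hχ₀_def, norm_mul, norm_neg, e1]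
      congr 1
      rw [show (α : ℂ) = ((1 * α : ℝ) : ℂ) by push_cast; ring, nexp]; ring_nf
    rw [e2]
    have h1 : ‖∫ u in Ioi y, gm u‖ ≤ ∫ u in Ioi y, ‖gm u‖ := norm_integral_le_integral_norm _
    have h2 : ∫ u in Ioi y, ‖gm u‖ ≤ ∫ u in Ioi y, Real.exp (-(α * y)) * ‖w u‖ := by
      refine setIntegral_mono_on igm.norm.integrableOn ((iw.const_mul _).integrableOn)
        measurableSet_Ioi fun u hu => ?_
      simp only [hgm_def, norm_mul]
      have e : ‖Complex.exp (-(α : ℂ) * u)‖ = Real.exp (-(α * u)) := by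
        rw [← neg_one_mul, show (-1 : ℂ) * (α : ℂ) = ((-1 * α : ℝ) : ℂ) by push_cast; ring, nexp]
        ring_nf
      rw [e]
      refine mul_le_mul_of_nonneg_right ?_ (norm_nonneg _)
      exact Real.exp_le_exp.mpr (by nlinarith [mem_Ioi.1 hu])
    have h3 : ∫ u in Ioi y, Real.exp (-(α * y)) * ‖w u‖ = Real.exp (-(α * y)) * ∫ u in Ioi y, ‖w u‖ :=
      MeasureTheory.integral_const_mul _ _
    have h4 : 0 ≤ ∫ u in Ioi y, ‖w u‖ := integral_nonneg fun u => norm_nonneg _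
    calc Real.exp (α * y) * ‖∫ u in Ioi y, gm u‖
        ≤ Real.exp (α * y) * (Real.exp (-(α * y)) * ∫ u in Ioi y, ‖w u‖) := by
          refine mul_le_mul_of_nonneg_left (h1.trans (h2.trans h3.le)) (Real.exp_pos _).le
      _ = ∫ u in Ioi y, ‖w u‖ := by
          rw [← mul_assoc, ← Real.exp_add]; simp
  have hξ₀b : ∀ y, ‖ξ₀ y‖ ≤ ∫ u in Iic y, ‖w u‖ := by
    intro y
    have e2 : ‖ξ₀ y‖ = Real.exp (-(α * y)) * ‖∫ u in Iic y, gp u‖ := by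
      simp only [hξ₀_def, norm_mul, hBp_def]
      congr 1
      rw [← neg_one_mul, show (-1 : ℂ) * (α : ℂ) = ((-1 * α : ℝ) : ℂ) by push_cast; ring, nexp]
      ring_nf
    rw [e2]
    have h1 : ‖∫ u in Iic y, gp u‖ ≤ ∫ u in Iic y, ‖gp u‖ := norm_integral_le_integral_norm _
    have h2 : ∫ u in Iic y, ‖gp u‖ ≤ ∫ u in Iic y, Real.exp (α * y) * ‖w u‖ := by
      refine setIntegral_mono_on igp.norm.integrableOn ((iw.const_mul _).integrableOn)
        measurableSet_Iic fun u hu => ?_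
      simp only [hgp_def, norm_mul]
      have e : ‖Complex.exp ((α : ℂ) * u)‖ = Real.exp (α * u) := by
        rw [show (α : ℂ) = ((1 * α : ℝ) : ℂ) by push_cast; ring, nexp]; ring_nf
      rw [e]
      refine mul_le_mul_of_nonneg_right ?_ (norm_nonneg _)
      exact Real.exp_le_exp.mpr (by nlinarith [mem_Iic.1 hu])
    have h3 : ∫ u in Iic y, Real.exp (α * y) * ‖w u‖ = Real.exp (α * y) * ∫ u in Iic y, ‖w u‖ :=
      MeasureTheory.integral_const_mul _ _
    calc Real.exp (-(α * y)) * ‖∫ u in Iic y, gp u‖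
        ≤ Real.exp (-(α * y)) * (Real.exp (α * y) * ∫ u in Iic y, ‖w u‖) := by
          refine mul_le_mul_of_nonneg_left (h1.trans (h2.trans h3.le)) (Real.exp_pos _).le
      _ = ∫ u in Iic y, ‖w u‖ := by
          rw [← mul_assoc, ← Real.exp_add]; simp
  have hL : ∀ y, (∫ u in Ioi y, ‖w u‖) + ∫ u in Iic y, ‖w u‖ = ∫ u, ‖w u‖ := by
    intro y
    rw [add_comm]
    exact integral_Iic_add_Ioi iw.integrableOn iw.integrableOn
  have hIoi_le : ∀ y, ∫ u in Ioi y, ‖w u‖ ≤ ∫ u, ‖w u‖ := fun y =>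
    setIntegral_le_integral iw (Eventually.of_forall fun u => norm_nonneg _)
  have hIic_le : ∀ y, ∫ u in Iic y, ‖w u‖ ≤ ∫ u, ‖w u‖ := fun y =>
    setIntegral_le_integral iw (Eventually.of_forall fun u => norm_nonneg _)
  set L : ℝ := ∫ u, ‖w u‖ with hL_def
  -- the homogeneous parts
  set χ : ℝ → ℂ := fun y => ψ₁ y + (α : ℂ) * ψ y with hχ_def
  set ξ : ℝ → ℂ := fun y => ψ₁ y - (α : ℂ) * ψ y with hξ_def
  have hχ : ∀ y, HasDerivAt χ ((α : ℂ) * χ y + w y) y := by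
    intro y
    have h := (hψ₁ y).fun_add ((hψ y).const_mul (α : ℂ))
    simp only [hχ_def]
    refine h.congr_deriv ?_
    simp only [hw_def]; ring
  have hξ : ∀ y, HasDerivAt ξ (-(α : ℂ) * ξ y + w y) y := by
    intro y
    have h := (hψ₁ y).fun_sub ((hψ y).const_mul (α : ℂ))
    simp only [hξ_def]
    refine h.congr_deriv ?_
    simp only [hw_def]; ring
  set dχ : ℝ → ℂ := fun y => χ y - χ₀ y with hdχ
  set dξ : ℝ → ℂ := fun y => ξ y - ξ₀ y with hdξ
  have hdχd : ∀ y, HasDerivAt dχ ((α : ℂ) * dχ y) y := fun y => by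
    simp only [hdχ]
    exact ((hχ y).fun_sub (hχ₀ y)).congr_deriv (by ring)
  have hdξd : ∀ y, HasDerivAt dξ (-(α : ℂ) * dξ y) y := fun y => by
    simp only [hdξ]
    exact ((hξ y).fun_sub (hξ₀ y)).congr_deriv (by ring)
  have edχ := Literature.Analysis.ODE.eq_mul_exp_of_deriv_eq (α : ℂ)
    (fun y => (hdχd y).differentiableAt) (fun y => (hdχd y).deriv)
  have edξ := Literature.Analysis.ODE.eq_mul_exp_of_deriv_eq (-(α : ℂ))
    (fun y => (hdξd y).differentiableAt) (fun y => (hdξd y).deriv)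
  set c : ℂ := dχ 0 with hc
  set c' : ℂ := dξ 0 with hc'
  -- `2αψ = χ₀ − ξ₀ + c e^{αy} − c' e^{−αy}`
  have hrep : ∀ y : ℝ, 2 * (α : ℂ) * ψ y
      = (χ₀ y - ξ₀ y) + (c * Complex.exp ((α : ℂ) * y) - c' * Complex.exp (-(α : ℂ) * y)) := by
    intro y
    have e1 : dχ y = c * Complex.exp ((α : ℂ) * y) := by rw [edχ]
    have e2 : dξ y = c' * Complex.exp (-(α : ℂ) * y) := by rw [edξ]
    simp only [hdχ, hdξ, hχ_def, hξ_def] at e1 e2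
    linear_combination e1 - e2
  set M' : ℝ := 2 * α * M + 2 * L with hM'
  have hbnd : ∀ y : ℝ, ‖c * Complex.exp ((α : ℂ) * y) - c' * Complex.exp (-(α : ℂ) * y)‖ ≤ M' := by
    intro y
    have e : c * Complex.exp ((α : ℂ) * y) - c' * Complex.exp (-(α : ℂ) * y)
        = 2 * (α : ℂ) * ψ y - (χ₀ y - ξ₀ y) := by rw [hrep y]; ring
    rw [e]
    have h1 : ‖2 * (α : ℂ) * ψ y‖ = 2 * α * ‖ψ y‖ := by
      rw [norm_mul, norm_mul, Complex.norm_real, Real.norm_eq_abs, abs_of_pos hα]; simp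
    calc ‖2 * (α : ℂ) * ψ y - (χ₀ y - ξ₀ y)‖ ≤ ‖2 * (α : ℂ) * ψ y‖ + ‖χ₀ y - ξ₀ y‖ := norm_sub_le _ _
      _ ≤ 2 * α * ‖ψ y‖ + (‖χ₀ y‖ + ‖ξ₀ y‖) := by rw [h1]; gcongr; exact norm_sub_le _ _
      _ ≤ 2 * α * M + 2 * L := by
          have := hM y; have := hχ₀b y; have := hξ₀b y; have := hIoi_le y; have := hIic_le y
          nlinarith
  have nEp : ∀ y : ℝ, ‖Complex.exp ((α : ℂ) * y)‖ = Real.exp (α * y) := fun y => by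
    rw [show (α : ℂ) = ((1 * α : ℝ) : ℂ) by push_cast; ring, nexp]; ring_nf
  have nEm : ∀ y : ℝ, ‖Complex.exp (-(α : ℂ) * y)‖ = Real.exp (-(α * y)) := fun y => by
    rw [← neg_one_mul, show (-1 : ℂ) * (α : ℂ) = ((-1 * α : ℝ) : ℂ) by push_cast; ring, nexp]
    ring_nf
  have hM'0 : 0 ≤ M' := le_trans (norm_nonneg _) (hbnd 0)
  have hc0 : c = 0 := by
    by_contra hne
    have hcpos : 0 < ‖c‖ := norm_pos_iff.mpr hne
    -- pick y ≥ 0 with e^{αy} > (M' + ‖c'‖)/‖c‖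
    have hev := (Real.tendsto_exp_atTop.comp (tendsto_id.const_mul_atTop hα)).eventually_gt_atTop
      ((M' + ‖c'‖) / ‖c‖)
    obtain ⟨y, hy0, hy⟩ := ((eventually_ge_atTop 0).and hev).exists
    simp only [Function.comp_apply, id_eq] at hy
    have h1 : ‖c‖ * Real.exp (α * y) ≤ M' + ‖c'‖ := by
      have h2 : ‖c' * Complex.exp (-(α : ℂ) * y)‖ ≤ ‖c'‖ := by
        rw [norm_mul, nEm]
        refine mul_le_of_le_one_right (norm_nonneg _) ?_
        rw [Real.exp_le_one_iff]; nlinarith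
      calc ‖c‖ * Real.exp (α * y) = ‖c * Complex.exp ((α : ℂ) * y)‖ := by rw [norm_mul, nEp]
        _ = ‖(c * Complex.exp ((α : ℂ) * y) - c' * Complex.exp (-(α : ℂ) * y))
              + c' * Complex.exp (-(α : ℂ) * y)‖ := by congr 1; ring
        _ ≤ ‖c * Complex.exp ((α : ℂ) * y) - c' * Complex.exp (-(α : ℂ) * y)‖ + ‖c' * Complex.exp (-(α : ℂ) * y)‖ :=
            norm_add_le _ _
        _ ≤ M' + ‖c'‖ := add_le_add (hbnd y) h2
    have h3 : (M' + ‖c'‖) / ‖c‖ < Real.exp (α * y) := hy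
    rw [div_lt_iff₀ hcpos] at h3
    nlinarith
  have hc'0 : c' = 0 := by
    by_contra hne
    have hcpos : 0 < ‖c'‖ := norm_pos_iff.mpr hne
    have hev := (Real.tendsto_exp_atTop.comp (tendsto_neg_atBot_atTop.comp (tendsto_id.const_mul_atBot hα))).eventually_gt_atTop
      ((M' + ‖c‖) / ‖c'‖)
    obtain ⟨y, hy0, hy⟩ := ((eventually_le_atBot 0).and hev).exists
    simp only [Function.comp_apply, id_eq] at hy
    have h1 : ‖c'‖ * Real.exp (-(α * y)) ≤ M' + ‖c‖ := by
      have e : -(c' * Complex.exp (-(α : ℂ) * y)) = (c * Complex.exp ((α : ℂ) * y) - c' * Complex.exp (-(α : ℂ) * y))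
          - c * Complex.exp ((α : ℂ) * y) := by ring
      have h2 : ‖c * Complex.exp ((α : ℂ) * y)‖ ≤ ‖c‖ := by
        rw [norm_mul, nEp]
        refine mul_le_of_le_one_right (norm_nonneg _) ?_
        rw [Real.exp_le_one_iff]; nlinarith
      calc ‖c'‖ * Real.exp (-(α * y)) = ‖-(c' * Complex.exp (-(α : ℂ) * y))‖ := by rw [norm_neg, norm_mul, nEm]
        _ ≤ ‖c * Complex.exp ((α : ℂ) * y) - c' * Complex.exp (-(α : ℂ) * y)‖ + ‖c * Complex.exp ((α : ℂ) * y)‖ := by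
            rw [e]; exact norm_sub_le _ _
        _ ≤ M' + ‖c‖ := add_le_add (hbnd y) h2
    have h3 : (M' + ‖c‖) / ‖c'‖ < Real.exp (-(α * y)) := hy
    rw [div_lt_iff₀ hcpos] at h3
    nlinarith
  -- conclusion
  have hfin : 2 * (α : ℂ) * ψ y₀ = χ₀ y₀ - ξ₀ y₀ := by
    rw [hrep y₀, hc0, hc'0]; ring
  have h1 : 2 * α * ‖ψ y₀‖ = ‖χ₀ y₀ - ξ₀ y₀‖ := by
    rw [← hfin, norm_mul, norm_mul, Complex.norm_real, Real.norm_eq_abs, abs_of_pos hα]; simp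
  have h2 : ‖χ₀ y₀ - ξ₀ y₀‖ ≤ L := by
    calc ‖χ₀ y₀ - ξ₀ y₀‖ ≤ ‖χ₀ y₀‖ + ‖ξ₀ y₀‖ := norm_sub_le _ _
      _ ≤ (∫ u in Ioi y₀, ‖w u‖) + ∫ u in Iic y₀, ‖w u‖ := add_le_add (hχ₀b y₀) (hξ₀b y₀)
      _ = L := hL y₀
  rw [le_div_iff₀ (by positivity)]
  linarith


/-! ## §3a Ceiling on the growth rate: `re σ + α² ≤ √(π/2)·|Re|` -/

/-- A continuous function `ℝ → ℂ` tending to `0` at `±∞` is bounded. [folklore] -/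
theorem bounded_of_tendsto_zero {ψ : ℝ → ℂ} (hc : Continuous ψ) (htop : Tendsto ψ atTop (𝓝 0))
    (hbot : Tendsto ψ atBot (𝓝 0)) : ∃ M, ∀ y, ‖ψ y‖ ≤ M := by
  have ht : Tendsto (fun y => ‖ψ y‖) atTop (𝓝 0) := tendsto_zero_iff_norm_tendsto_zero.mp htop
  have hb : Tendsto (fun y => ‖ψ y‖) atBot (𝓝 0) := tendsto_zero_iff_norm_tendsto_zero.mp hbot
  obtain ⟨R₂, hR₂⟩ := eventually_atTop.1 (ht.eventually (Iio_mem_nhds one_pos))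
  obtain ⟨R₁, hR₁⟩ := eventually_atBot.1 (hb.eventually (Iio_mem_nhds one_pos))
  obtain ⟨K, hK⟩ := (isCompact_Icc : IsCompact (Icc R₁ R₂)).exists_bound_of_continuousOn hc.continuousOn
  refine ⟨max K 1, fun y => ?_⟩
  rcases le_or_gt y R₁ with h1 | h1
  · exact le_trans (le_of_lt (hR₁ y h1)) (le_max_right _ _)
  rcases le_or_gt R₂ y with h2 | h2
  · exact le_trans (le_of_lt (hR₂ y h2)) (le_max_right _ _)
  · exact le_trans (hK y ⟨h1.le, h2.le⟩) (le_max_left _ _)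

/-- `∫ e^{−u²/2} du = √(2π)`. [folklore] -/
theorem gaussian_moment_zero : ∫ u : ℝ, Real.exp (-(u ^ 2) / 2) = Real.sqrt (2 * Real.pi) := by
  have h := integral_gaussian (1 / 2)
  have e : (fun u : ℝ => Real.exp (-(u ^ 2) / 2)) = fun x => Real.exp (-(1 / 2) * x ^ 2) := by
    funext u; congr 1; ring
  rw [e, h]
  congr 1; ring

/-- `|u| ≤ 2 e^{u²/8}`. [folklore] -/
theorem abs_le_two_mul_exp (u : ℝ) : |u| ≤ 2 * Real.exp (u ^ 2 / 8) := by
  have h1 : u ^ 2 / 8 + 1 ≤ Real.exp (u ^ 2 / 8) := Real.add_one_le_exp _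
  have h2 : |u| ≤ 2 * (u ^ 2 / 8 + 1) := by
    rcases le_or_gt 0 u with h | h
    · rw [abs_of_nonneg h]; nlinarith [sq_nonneg (u / 2 - 1)]
    · rw [abs_of_neg h]; nlinarith [sq_nonneg (u / 2 + 1)]
  linarith

/-- `∫ u² e^{−u²/2} du = √(2π)` (integrate `(u e^{−u²/2})' = e^{−u²/2} − u² e^{−u²/2}` over `ℝ`).
[folklore] -/
theorem gaussian_moment_two : ∫ u : ℝ, u ^ 2 * Real.exp (-(u ^ 2) / 2) = Real.sqrt (2 * Real.pi) := by
  set g : ℝ → ℝ := fun u => Real.exp (-(u ^ 2) / 2) with hg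
  have hgd : ∀ u, HasDerivAt g (-u * g u) u := by
    intro u
    have := ((hasDerivAt_pow 2 u).neg.div_const 2).exp
    simp only [hg]
    refine this.congr_deriv ?_
    simp; ring
  have ig : Integrable g := by
    have := integrable_exp_neg_mul_sq (by norm_num : (0:ℝ) < 1 / 2)
    refine this.congr (Eventually.of_forall fun u => ?_)
    simp only [hg]; congr 1; ring
  have iG8 : Integrable fun u : ℝ => Real.exp (-(1 / 8) * u ^ 2) :=
    integrable_exp_neg_mul_sq (by norm_num : (0:ℝ) < 1 / 8)
  -- domination `|u|^k e^{-u²/2} ≤ const · e^{-u²/8}` for k = 1, 2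
  have dom1 : ∀ u : ℝ, |u| * Real.exp (-(u ^ 2) / 2) ≤ 2 * Real.exp (-(1 / 8) * u ^ 2) := by
    intro u
    have h := abs_le_two_mul_exp u
    have e : Real.exp (u ^ 2 / 8) * Real.exp (-(u ^ 2) / 2) ≤ Real.exp (-(1 / 8) * u ^ 2) := by
      rw [← Real.exp_add]; exact Real.exp_le_exp.mpr (by nlinarith [sq_nonneg u])
    calc |u| * Real.exp (-(u ^ 2) / 2) ≤ 2 * Real.exp (u ^ 2 / 8) * Real.exp (-(u ^ 2) / 2) := by
          gcongr
      _ ≤ 2 * Real.exp (-(1 / 8) * u ^ 2) := by rw [mul_assoc]; gcongr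
  have dom2 : ∀ u : ℝ, u ^ 2 * Real.exp (-(u ^ 2) / 2) ≤ 4 * Real.exp (-(1 / 8) * u ^ 2) := by
    intro u
    have h := abs_le_two_mul_exp u
    have h2 : u ^ 2 ≤ 4 * Real.exp (u ^ 2 / 4) := by
      have : |u| ^ 2 ≤ (2 * Real.exp (u ^ 2 / 8)) ^ 2 := by gcongr
      rw [sq_abs] at this
      calc u ^ 2 ≤ (2 * Real.exp (u ^ 2 / 8)) ^ 2 := this
        _ = 4 * Real.exp (u ^ 2 / 4) := by rw [mul_pow, ← Real.exp_nat_mul]; ring_nf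
    have e : Real.exp (u ^ 2 / 4) * Real.exp (-(u ^ 2) / 2) ≤ Real.exp (-(1 / 8) * u ^ 2) := by
      rw [← Real.exp_add]; exact Real.exp_le_exp.mpr (by nlinarith [sq_nonneg u])
    calc u ^ 2 * Real.exp (-(u ^ 2) / 2) ≤ 4 * Real.exp (u ^ 2 / 4) * Real.exp (-(u ^ 2) / 2) := by
          gcongr
      _ ≤ 4 * Real.exp (-(1 / 8) * u ^ 2) := by rw [mul_assoc]; gcongr
  set f : ℝ → ℝ := fun u => u * g u with hf
  have hfd : ∀ u, HasDerivAt f (g u - u ^ 2 * g u) u := by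
    intro u
    have := (hasDerivAt_id' u).fun_mul (hgd u)
    simp only [hf]
    refine this.congr_deriv ?_; ring
  have i2 : Integrable fun u => u ^ 2 * g u :=
    (iG8.const_mul 4).mono' (by fun_prop) (Eventually.of_forall fun u => by
      rw [Real.norm_of_nonneg (by positivity)]; exact dom2 u)
  have i1 : Integrable f :=
    (iG8.const_mul 2).mono' (by fun_prop) (Eventually.of_forall fun u => by
      simp only [hf, hg, norm_mul, Real.norm_eq_abs, abs_of_pos (Real.exp_pos _)]; exact dom1 u)
  have h0 : ∫ u, (g u - u ^ 2 * g u) = 0 :=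
    integral_eq_zero_of_hasDerivAt_of_integrable hfd (ig.sub i2) i1
  rw [integral_sub ig i2] at h0
  have : ∫ u, u ^ 2 * g u = ∫ u, g u := by linarith
  rw [this]
  exact gaussian_moment_zero

/-- **AM–GM product bound through a double integral.** For real `p, q, n ≥ 0`-valued functions
with the displayed integrabilities, `(∫ p n)(∫ q n) ≤ ½[(∫ p²) + (∫ q²)] ∫ n²` (pointwise
`p(x)n(x)q(y)n(y) ≤ ½(p(x)²n(y)² + q(y)²n(x)²)` integrated over `ℝ²`, Tonelli for products).
[folklore] -/
theorem integral_mul_integral_le {p q n : ℝ → ℝ} (ipn : Integrable fun x => p x * n x)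
    (iqn : Integrable fun x => q x * n x) (ip2 : Integrable fun x => p x ^ 2)
    (iq2 : Integrable fun x => q x ^ 2) (in2 : Integrable fun x => n x ^ 2) :
    (∫ x, p x * n x) * (∫ x, q x * n x)
      ≤ (1 / 2) * ((∫ x, p x ^ 2) + ∫ x, q x ^ 2) * ∫ x, n x ^ 2 := by
  have e1 : (∫ x, p x * n x) * (∫ x, q x * n x)
      = ∫ z : ℝ × ℝ, (p z.1 * n z.1) * (q z.2 * n z.2) ∂((volume : Measure ℝ).prod volume) :=
    (integral_prod_mul (fun x => p x * n x) (fun x => q x * n x)).symm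
  have e2 : ∫ z : ℝ × ℝ, p z.1 ^ 2 * n z.2 ^ 2 ∂((volume : Measure ℝ).prod volume)
      = (∫ x, p x ^ 2) * ∫ x, n x ^ 2 := integral_prod_mul (fun x => p x ^ 2) (fun x => n x ^ 2)
  have e3 : ∫ z : ℝ × ℝ, n z.1 ^ 2 * q z.2 ^ 2 ∂((volume : Measure ℝ).prod volume)
      = (∫ x, n x ^ 2) * ∫ x, q x ^ 2 := integral_prod_mul (fun x => n x ^ 2) (fun x => q x ^ 2)
  have iL : Integrable (fun z : ℝ × ℝ => (p z.1 * n z.1) * (q z.2 * n z.2)) ((volume : Measure ℝ).prod volume) :=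
    ipn.mul_prod iqn
  have iR : Integrable (fun z : ℝ × ℝ => (1 / 2) * (p z.1 ^ 2 * n z.2 ^ 2 + n z.1 ^ 2 * q z.2 ^ 2))
      ((volume : Measure ℝ).prod volume) :=
    ((ip2.mul_prod in2).add (in2.mul_prod iq2)).const_mul _
  have hmono := integral_mono iL iR fun z => by
    show (p z.1 * n z.1) * (q z.2 * n z.2) ≤ (1 / 2) * (p z.1 ^ 2 * n z.2 ^ 2 + n z.1 ^ 2 * q z.2 ^ 2)
    nlinarith [sq_nonneg (p z.1 * n z.2 - q z.2 * n z.1)]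
  rw [e1]
  refine hmono.trans (le_of_eq ?_)
  rw [MeasureTheory.integral_const_mul, integral_add (ip2.mul_prod in2) (in2.mul_prod iq2), e2, e3]
  ring

/-- **Ceiling on the growth rate of Gaussian-class modes of the Burgers layer.** For any mode of
the FULL linearised stretched-vorticity equation about the Burgers layer (the crux's equation, any
real `Re`, `α > 0`, `ψ ∈ C⁴` bounded, `|ω| ≤ Ce^{−y²/4}`, `ω ≢ 0`):
`re σ + α² ≤ √(π/2)·|Re|`. In Beronov–Kida's units (`R = √(π/2)·Re`) this reads
`re σ ≤ R − α²`: growth is at most LINEAR in the Reynolds number, so any admissible constant in the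
crux satisfies `c₀ ≤ √(π/2) ≈ 1.2533` (Høiland's `½ max|U'|` would give `½`; the present bound is the
one available in the vorticity–Gaussian framework: forced Weber inequality + Green's-function sup
bound `‖ψ‖_∞ ≤ ‖ω‖₁/(2α)` + AM–GM with `∫e^{−y²/2} = ∫y²e^{−y²/2} = √(2π)`). [folklore] -/
theorem re_add_sq_le_of_mode {α Re C M : ℝ} (hα : 0 < α) {σ : ℂ} {ψ : ℝ → ℂ} (hψ : ContDiff ℝ 4 ψ)
    (hM : ∀ y, ‖ψ y‖ ≤ M)
    (hdecay : ∀ y, ‖-(iteratedDeriv 2 ψ y - (α : ℂ) ^ 2 * ψ y)‖ ≤ C * Real.exp (-(y ^ 2) / 4))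
    (heq : ∀ y : ℝ, let U : ℝ → ℝ := fun y => ∫ s in (0:ℝ)..y, Real.exp (-(s ^ 2) / 2)
      let U'' : ℝ → ℝ := fun y => -(y * Real.exp (-(y ^ 2) / 2))
      let ω : ℝ → ℂ := fun y => -(iteratedDeriv 2 ψ y - (α : ℂ) ^ 2 * ψ y)
      σ * ω y = -(Complex.I * α * Re) * ((U y : ℂ) * ω y + (U'' y : ℂ) * ψ y) + ω y
        + (y : ℂ) * deriv ω y + iteratedDeriv 2 ω y - (α : ℂ) ^ 2 * ω y)
    (hne : ∃ y, -(iteratedDeriv 2 ψ y - (α : ℂ) ^ 2 * ψ y) ≠ 0) :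
    σ.re + α ^ 2 ≤ Real.sqrt (Real.pi / 2) * |Re| := by
  set U : ℝ → ℝ := fun y => ∫ s in (0:ℝ)..y, Real.exp (-(s ^ 2) / 2) with hU_def
  set U'' : ℝ → ℝ := fun y => -(y * Real.exp (-(y ^ 2) / 2)) with hU''_def
  set ω : ℝ → ℂ := fun y => -(iteratedDeriv 2 ψ y - (α : ℂ) ^ 2 * ψ y) with hω_def
  change ∀ y, ‖ω y‖ ≤ C * Real.exp (-(y ^ 2) / 4) at hdecay
  change ∀ y, σ * ω y = -(Complex.I * α * Re) * ((U y : ℂ) * ω y + (U'' y : ℂ) * ψ y) + ω y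
    + (y : ℂ) * deriv ω y + iteratedDeriv 2 ω y - (α : ℂ) ^ 2 * ω y at heq
  change ∃ y, ω y ≠ 0 at hne
  have hC0 : 0 ≤ C := by
    have := hdecay 0
    simp only [ne_eq, OfNat.ofNat_ne_zero, not_false_eq_true, zero_pow, neg_zero, zero_div,
      Real.exp_zero, mul_one] at this
    exact (norm_nonneg _).trans this
  have hM0 : 0 ≤ M := (norm_nonneg _).trans (hM 0)
  -- regularity
  have hi2 : ContDiff ℝ 2 (iteratedDeriv 2 ψ) := by
    rw [iteratedDeriv_eq_iterate]; exact hψ.iterate_deriv' 2 2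
  have hω2 : ContDiff ℝ 2 ω := (hi2.sub (contDiff_const.mul (hψ.of_le (by norm_num)))).neg
  have cω : Continuous ω := hω2.continuous
  have hωd : Differentiable ℝ ω := hω2.differentiable (by norm_num)
  have hω1d : Differentiable ℝ (deriv ω) := by
    have := hω2.differentiable_iteratedDeriv 1 (by norm_num)
    simpa [iteratedDeriv_one] using this
  have hD : ∀ y, HasDerivAt ω (deriv ω y) y := fun y => (hωd y).hasDerivAt
  have hD1 : ∀ y, HasDerivAt (deriv ω) (deriv (deriv ω) y) y := fun y => (hω1d y).hasDerivAt
  have hit : ∀ y, iteratedDeriv 2 ω y = deriv (deriv ω) y := fun y => by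
    rw [iteratedDeriv_succ, iteratedDeriv_one]
  have hψd : Differentiable ℝ ψ := hψ.differentiable (by norm_num)
  have hψ1d : Differentiable ℝ (deriv ψ) := by
    have := hψ.differentiable_iteratedDeriv 1 (by norm_num)
    simpa [iteratedDeriv_one] using this
  have cψ : Continuous ψ := hψd.continuous
  -- Gaussian conjugation
  set E : ℝ → ℂ := fun y => ((Real.exp (y ^ 2 / 4) : ℝ) : ℂ) with hE_def
  have cE : Continuous E := by simp only [hE_def]; fun_prop
  have hEd : ∀ y : ℝ, HasDerivAt E ((y : ℂ) / 2 * E y) y := by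
    intro y
    have h1 : HasDerivAt (fun x : ℝ => Real.exp (x ^ 2 / 4)) (Real.exp (y ^ 2 / 4) * (2 * y / 4)) y := by
      have := ((hasDerivAt_pow 2 y).div_const 4).exp
      refine this.congr_deriv ?_
      simp
    have h2 := h1.ofReal_comp
    rw [hE_def]
    refine h2.congr_deriv ?_
    push_cast; ring
  have nE : ∀ y, ‖E y‖ = Real.exp (y ^ 2 / 4) := fun y => by
    simp only [hE_def, Complex.norm_real, Real.norm_eq_abs, abs_of_pos (Real.exp_pos _)]
  set W : ℝ → ℂ := fun y => E y * ω y with hW_def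
  set W₁ : ℝ → ℂ := fun y => E y * ((y : ℂ) / 2 * ω y + deriv ω y) with hW₁_def
  set W₂ : ℝ → ℂ := fun y => E y * ((y : ℂ) / 2 * ((y : ℂ) / 2 * ω y + deriv ω y)
    + ((1 : ℂ) / 2 * ω y + (y : ℂ) / 2 * deriv ω y + deriv (deriv ω) y)) with hW₂_def
  have hW : ∀ y, HasDerivAt W (W₁ y) y := by
    intro y
    rw [hW_def, hW₁_def]
    exact ((hEd y).fun_mul (hD y)).congr_deriv (by ring)
  have hid : ∀ y : ℝ, HasDerivAt (fun x : ℝ => (x : ℂ) / 2) ((1 : ℂ) / 2) y := by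
    intro y
    have := ((hasDerivAt_id' y).ofReal_comp).div_const (2 : ℂ)
    refine this.congr_deriv ?_
    simp
  have hW₁ : ∀ y, HasDerivAt W₁ (W₂ y) y := by
    intro y
    rw [hW₁_def, hW₂_def]
    exact ((hEd y).fun_mul (((hid y).fun_mul (hD y)).fun_add (hD1 y))).congr_deriv (by ring)
  have hWb : ∀ y, ‖W y‖ ≤ C := by
    intro y
    have h1 : ‖W y‖ = Real.exp (y ^ 2 / 4) * ‖ω y‖ := by simp only [hW_def, norm_mul, nE]
    rw [h1]
    have h2 := mul_le_mul_of_nonneg_left (hdecay y) (Real.exp_pos (y ^ 2 / 4)).le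
    have h3 : Real.exp (y ^ 2 / 4) * (C * Real.exp (-(y ^ 2) / 4)) = C := by
      rw [mul_comm, mul_assoc, ← Real.exp_add]
      have : -(y ^ 2) / 4 + y ^ 2 / 4 = 0 := by ring
      rw [this, Real.exp_zero, mul_one]
    linarith
  have nWω : ∀ y, ‖ω y‖ = Real.exp (-(y ^ 2) / 4) * ‖W y‖ := by
    intro y
    simp only [hW_def, norm_mul, nE]
    rw [← mul_assoc, ← Real.exp_add]
    have : -(y ^ 2) / 4 + y ^ 2 / 4 = 0 := by ring
    rw [this, Real.exp_zero, one_mul]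
  -- the forcing
  set f : ℝ → ℂ := fun y => E y * (Complex.I * α * Re * (U'' y : ℂ) * ψ y) with hf_def
  have cU'' : Continuous U'' := by simp only [hU''_def]; fun_prop
  have cf : Continuous f := by simp only [hf_def]; fun_prop
  have nf : ∀ y, ‖f y‖ = α * |Re| * (|y| * Real.exp (-(y ^ 2) / 4)) * ‖ψ y‖ := by
    intro y
    simp only [hf_def, hU''_def, norm_mul, nE, Complex.norm_I, Complex.norm_real, Real.norm_eq_abs,
      abs_of_pos hα, abs_of_pos (Real.exp_pos _), norm_neg]
    have e : Real.exp (y ^ 2 / 4) * Real.exp (-(y ^ 2) / 2) = Real.exp (-(y ^ 2) / 4) := by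
      rw [← Real.exp_add]; congr 1; ring
    calc Real.exp (y ^ 2 / 4) * (1 * α * |Re| * (|y| * Real.exp (-(y ^ 2) / 2)) * ‖ψ y‖)
        = α * |Re| * (|y| * (Real.exp (y ^ 2 / 4) * Real.exp (-(y ^ 2) / 2))) * ‖ψ y‖ := by ring
      _ = α * |Re| * (|y| * Real.exp (-(y ^ 2) / 4)) * ‖ψ y‖ := by rw [e]
  have iG8 : Integrable fun u : ℝ => Real.exp (-(1 / 8) * u ^ 2) :=
    integrable_exp_neg_mul_sq (by norm_num : (0:ℝ) < 1 / 8)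
  have dom : ∀ y : ℝ, |y| * Real.exp (-(y ^ 2) / 4) ≤ 2 * Real.exp (-(1 / 8) * y ^ 2) := by
    intro y
    have h := abs_le_two_mul_exp y
    have e : Real.exp (y ^ 2 / 8) * Real.exp (-(y ^ 2) / 4) = Real.exp (-(1 / 8) * y ^ 2) := by
      rw [← Real.exp_add]; congr 1; ring
    calc |y| * Real.exp (-(y ^ 2) / 4) ≤ 2 * Real.exp (y ^ 2 / 8) * Real.exp (-(y ^ 2) / 4) := by
          gcongr
      _ = 2 * Real.exp (-(1 / 8) * y ^ 2) := by rw [mul_assoc, e]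
  have ifW : Integrable fun y => ‖f y‖ * ‖W y‖ := by
    refine ((iG8.const_mul (α * |Re| * 2 * M * C))).mono' (by fun_prop) (Eventually.of_forall fun y => ?_)
    rw [Real.norm_of_nonneg (by positivity), nf]
    have h1 := dom y
    have h2 := hM y
    have h3 := hWb y
    have h4 : 0 ≤ |y| * Real.exp (-(y ^ 2) / 4) := by positivity
    calc α * |Re| * (|y| * Real.exp (-(y ^ 2) / 4)) * ‖ψ y‖ * ‖W y‖
        ≤ α * |Re| * (2 * Real.exp (-(1 / 8) * y ^ 2)) * M * C := by
          gcongr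
      _ = α * |Re| * 2 * M * C * Real.exp (-(1 / 8) * y ^ 2) := by ring
  -- the conjugated, forced equation
  set μ : ℝ := σ.re + α ^ 2 - 1 / 2 with hμ_def
  have hWeq : ∀ y, W₂ y = ((y : ℂ) ^ 2 / 4 + (μ : ℂ) + Complex.I * ((σ.im + α * Re * U y : ℝ) : ℂ)) * W y + f y := by
    intro y
    have h1 := heq y
    rw [hit y] at h1
    simp only [hW₂_def, hW_def, hμ_def, hf_def]
    push_cast
    linear_combination (-(E y)) * h1 + (-(E y) * ω y) * Complex.re_add_im σ
  obtain ⟨iW2, hineq⟩ := weber_complex_forced (fun y => σ.im + α * Re * U y) hW hW₁ hWb cf ifW hWeq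
  -- Green's-function bound on ψ
  have hwω : ∀ y, iteratedDeriv 2 ψ y - (α : ℂ) ^ 2 * ψ y = -ω y := fun y => by simp only [hω_def, neg_neg]
  have hitψ : ∀ u, iteratedDeriv 2 ψ u = deriv (deriv ψ) u := fun u => by
    rw [iteratedDeriv_succ, iteratedDeriv_one]
  have e2 : ∀ u, deriv (deriv ψ) u - (α : ℂ) ^ 2 * ψ u = -ω u := fun u => by
    rw [← hitψ u]; exact hwω u
  have hwc' : Continuous fun u => deriv (deriv ψ) u - (α : ℂ) ^ 2 * ψ u := by
    have : (fun u => deriv (deriv ψ) u - (α : ℂ) ^ 2 * ψ u) = fun u => -ω u := funext e2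
    rw [this]; exact cω.neg
  have hwd' : ∀ u, ‖deriv (deriv ψ) u - (α : ℂ) ^ 2 * ψ u‖ ≤ C * Real.exp (-(u ^ 2) / 4) := fun u => by
    rw [e2 u, norm_neg]; exact hdecay u
  have hG : ∀ y, ‖ψ y‖ ≤ (∫ u, ‖ω u‖) / (2 * α) := by
    intro y
    have h := green_sup_bound hα (fun y => (hψd y).hasDerivAt) (fun y => (hψ1d y).hasDerivAt) hM hwc' hwd' y
    have e3 : (fun u => ‖deriv (deriv ψ) u - (α : ℂ) ^ 2 * ψ u‖) = fun u => ‖ω u‖ :=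
      funext fun u => by rw [e2 u, norm_neg]
    rw [e3] at h
    exact h
  -- the two weighted L¹ norms of W
  set pφ : ℝ → ℝ := fun y => Real.exp (-(y ^ 2) / 4) with hpφ
  set qχ : ℝ → ℝ := fun y => |y| * Real.exp (-(y ^ 2) / 4) with hqχ
  set nW : ℝ → ℝ := fun y => ‖W y‖ with hnW
  have iφn : Integrable fun y => pφ y * nW y := by
    have : Integrable fun u : ℝ => C * Real.exp (-(1 / 4) * u ^ 2) :=
      (integrable_exp_neg_mul_sq (by norm_num : (0:ℝ) < 1 / 4)).const_mul _
    refine this.mono' (by fun_prop) (Eventually.of_forall fun y => ?_)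
    rw [Real.norm_of_nonneg (by positivity)]
    simp only [hpφ, hnW]
    calc Real.exp (-(y ^ 2) / 4) * ‖W y‖ ≤ Real.exp (-(y ^ 2) / 4) * C := by gcongr; exact hWb y
      _ = C * Real.exp (-(1 / 4) * y ^ 2) := by rw [mul_comm]; congr 1; congr 1; ring
  have iχn : Integrable fun y => qχ y * nW y := by
    refine ((iG8.const_mul (2 * C))).mono' (by fun_prop) (Eventually.of_forall fun y => ?_)
    rw [Real.norm_of_nonneg (by positivity)]
    simp only [hqχ, hnW]
    calc |y| * Real.exp (-(y ^ 2) / 4) * ‖W y‖ ≤ 2 * Real.exp (-(1 / 8) * y ^ 2) * C :=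
          mul_le_mul (dom y) (hWb y) (norm_nonneg _) (by positivity)
      _ = 2 * C * Real.exp (-(1 / 8) * y ^ 2) := by ring
  have iφ2 : Integrable fun y => pφ y ^ 2 := by
    have := integrable_exp_neg_mul_sq (by norm_num : (0:ℝ) < 1 / 2)
    refine this.congr (Eventually.of_forall fun y => ?_)
    simp only [hpφ]; rw [← Real.exp_nat_mul]; congr 1; push_cast; ring
  have eχ2 : ∀ y, qχ y ^ 2 = y ^ 2 * Real.exp (-(y ^ 2) / 2) := fun y => by
    simp only [hqχ]; rw [mul_pow, sq_abs, ← Real.exp_nat_mul]; congr 1; push_cast; ring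
  have iχ2 : Integrable fun y => qχ y ^ 2 := by
    have h4 : Integrable fun u : ℝ => 4 * Real.exp (-(1 / 8) * u ^ 2) := iG8.const_mul 4
    refine h4.mono' (by fun_prop) (Eventually.of_forall fun y => ?_)
    rw [Real.norm_of_nonneg (by positivity), eχ2]
    have h := abs_le_two_mul_exp y
    have h2 : y ^ 2 ≤ 4 * Real.exp (y ^ 2 / 4) := by
      have : |y| ^ 2 ≤ (2 * Real.exp (y ^ 2 / 8)) ^ 2 := by gcongr
      rw [sq_abs] at this
      calc y ^ 2 ≤ (2 * Real.exp (y ^ 2 / 8)) ^ 2 := this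
        _ = 4 * Real.exp (y ^ 2 / 4) := by rw [mul_pow, ← Real.exp_nat_mul]; ring_nf
    have e : Real.exp (y ^ 2 / 4) * Real.exp (-(y ^ 2) / 2) ≤ Real.exp (-(1 / 8) * y ^ 2) := by
      rw [← Real.exp_add]; exact Real.exp_le_exp.mpr (by nlinarith [sq_nonneg y])
    calc y ^ 2 * Real.exp (-(y ^ 2) / 2) ≤ 4 * Real.exp (y ^ 2 / 4) * Real.exp (-(y ^ 2) / 2) := by
          gcongr
      _ ≤ 4 * Real.exp (-(1 / 8) * y ^ 2) := by rw [mul_assoc]; gcongr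
  have Iφ2 : ∫ y, pφ y ^ 2 = Real.sqrt (2 * Real.pi) := by
    rw [← gaussian_moment_zero]
    refine integral_congr_ae (Eventually.of_forall fun y => ?_)
    simp only [hpφ]; rw [← Real.exp_nat_mul]; congr 1; push_cast; ring
  have Iχ2 : ∫ y, qχ y ^ 2 = Real.sqrt (2 * Real.pi) := by
    rw [← gaussian_moment_two]
    exact integral_congr_ae (Eventually.of_forall fun y => eχ2 y)
  have in2 : Integrable fun y => nW y ^ 2 := by simpa only [hnW] using iW2
  -- ∫‖f‖‖W‖ ≤ α|Re| · (L/(2α)) · B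
  set L : ℝ := ∫ y, pφ y * nW y with hL
  set B : ℝ := ∫ y, qχ y * nW y with hB
  set N : ℝ := ∫ y, nW y ^ 2 with hN
  have hLω : ∫ u, ‖ω u‖ = L := by
    simp only [hL, hpφ, hnW]
    exact integral_congr_ae (Eventually.of_forall fun y => nWω y)
  have hL0 : 0 ≤ L := by rw [← hLω]; exact integral_nonneg fun u => norm_nonneg _
  have hstep1 : ∫ y, ‖f y‖ * ‖W y‖ ≤ (|Re| / 2 * L) * B := by
    have hpt : ∀ y, ‖f y‖ * ‖W y‖ ≤ (|Re| / 2 * L) * (qχ y * nW y) := by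
      intro y
      rw [nf]
      simp only [hqχ, hnW]
      have h1 := hG y
      rw [hLω] at h1
      have h2 : 0 ≤ |y| * Real.exp (-(y ^ 2) / 4) := by positivity
      have h3 : 0 ≤ ‖W y‖ := norm_nonneg _
      calc α * |Re| * (|y| * Real.exp (-(y ^ 2) / 4)) * ‖ψ y‖ * ‖W y‖
          ≤ α * |Re| * (|y| * Real.exp (-(y ^ 2) / 4)) * (L / (2 * α)) * ‖W y‖ := by gcongr
        _ = (|Re| / 2 * L) * (|y| * Real.exp (-(y ^ 2) / 4) * ‖W y‖) := by
            field_simp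
    calc ∫ y, ‖f y‖ * ‖W y‖ ≤ ∫ y, (|Re| / 2 * L) * (qχ y * nW y) :=
          integral_mono ifW (iχn.const_mul _) hpt
      _ = (|Re| / 2 * L) * B := by rw [MeasureTheory.integral_const_mul]
  have hstep2 : L * B ≤ Real.sqrt (2 * Real.pi) * N := by
    have h := integral_mul_integral_le iφn iχn iφ2 iχ2 in2
    rw [Iφ2, Iχ2] at h
    simp only [hL, hB, hN]
    linarith
  have hRe0 : 0 ≤ |Re| := abs_nonneg _
  have hmain : (μ + 1 / 2) * N ≤ (|Re| / 2 * Real.sqrt (2 * Real.pi)) * N := by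
    have h1 : (μ + 1 / 2) * N ≤ ∫ y, ‖f y‖ * ‖W y‖ := by simpa only [hN, hnW] using hineq
    calc (μ + 1 / 2) * N ≤ (|Re| / 2 * L) * B := h1.trans hstep1
      _ = |Re| / 2 * (L * B) := by ring
      _ ≤ |Re| / 2 * (Real.sqrt (2 * Real.pi) * N) := by gcongr
      _ = (|Re| / 2 * Real.sqrt (2 * Real.pi)) * N := by ring
  -- N > 0 since ω ≢ 0
  have hN0 : 0 < N := by
    have hN0' : 0 ≤ N := integral_nonneg fun y => by positivity
    rcases hN0'.lt_or_eq with h | h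
    · exact h
    · exfalso
      have hae := (integral_eq_zero_iff_of_nonneg (fun y => by positivity) in2).1 h.symm
      have cn : Continuous fun y => nW y ^ 2 := by simp only [hnW, hW_def]; fun_prop
      have hzero := (cn.ae_eq_iff_eq volume continuous_const).1 hae
      obtain ⟨y₁, hy₁⟩ := hne
      have h1 : nW y₁ ^ 2 = 0 := congrFun hzero y₁
      simp only [hnW, hW_def, norm_mul, nE] at h1
      have : ‖ω y₁‖ = 0 := by
        rcases mul_eq_zero.1 (pow_eq_zero_iff two_ne_zero |>.1 h1) with h2 | h2
        · exact absurd h2 (Real.exp_pos _).ne'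
        · exact h2
      exact hy₁ (norm_eq_zero.1 this)
  have hfin : μ + 1 / 2 ≤ |Re| / 2 * Real.sqrt (2 * Real.pi) := le_of_mul_le_mul_right hmain hN0
  have hsq : Real.sqrt (2 * Real.pi) = 2 * Real.sqrt (Real.pi / 2) := by
    rw [show (2 * Real.pi) = 2 ^ 2 * (Real.pi / 2) by ring, Real.sqrt_mul (by norm_num), Real.sqrt_sq (by norm_num)]
  rw [hsq] at hfin
  simp only [hμ_def] at hfin
  linarith


/-! ## §2 Load-bearing: the inflection-point coupling `U''ψ` and the threshold `Re₂` -/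

/-- **No instability without the coupling term.** Let `ψ ∈ C⁴`, `ω = −(ψ'' − α²ψ)` with the
Gaussian bound `|ω| ≤ C e^{−y²/4}`, and suppose the linearised stretched-vorticity equation holds
WITHOUT the inflection-point coupling `U''ψ`:
`σω = −iαRe·g(y)·ω + ω + yω' + ω'' − α²ω` for some real function `g` (for the Burgers layer,
`g = U`). If `ω ≢ 0` then `re σ ≤ −α²` — at every `Re`. (Substituting `W = e^{y²/4}ω` gives
`W'' = (y²/4 + σ + α² − ½ + iαRe·g)W` with `W` bounded; apply `weber_complex`.) [folklore] -/
theorem re_le_of_noCoupling {α Re C : ℝ} {σ : ℂ} {ψ : ℝ → ℂ} (g : ℝ → ℝ) (hψ : ContDiff ℝ 4 ψ)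
    (hdecay : ∀ y, ‖-(iteratedDeriv 2 ψ y - (α : ℂ) ^ 2 * ψ y)‖ ≤ C * Real.exp (-(y ^ 2) / 4))
    (heq : ∀ y, σ * (-(iteratedDeriv 2 ψ y - (α : ℂ) ^ 2 * ψ y))
      = -(Complex.I * α * Re) * ((g y : ℂ) * (-(iteratedDeriv 2 ψ y - (α : ℂ) ^ 2 * ψ y)))
        + (-(iteratedDeriv 2 ψ y - (α : ℂ) ^ 2 * ψ y))
        + (y : ℂ) * deriv (fun y => -(iteratedDeriv 2 ψ y - (α : ℂ) ^ 2 * ψ y)) y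
        + iteratedDeriv 2 (fun y => -(iteratedDeriv 2 ψ y - (α : ℂ) ^ 2 * ψ y)) y
        - (α : ℂ) ^ 2 * (-(iteratedDeriv 2 ψ y - (α : ℂ) ^ 2 * ψ y)))
    (hne : ∃ y, -(iteratedDeriv 2 ψ y - (α : ℂ) ^ 2 * ψ y) ≠ 0) : σ.re ≤ -α ^ 2 := by
  set ω : ℝ → ℂ := fun y => -(iteratedDeriv 2 ψ y - (α : ℂ) ^ 2 * ψ y) with hω_def
  change ∀ y, ‖ω y‖ ≤ C * Real.exp (-(y ^ 2) / 4) at hdecay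
  change ∀ y, σ * ω y = -(Complex.I * α * Re) * ((g y : ℂ) * ω y) + ω y + (y : ℂ) * deriv ω y
    + iteratedDeriv 2 ω y - (α : ℂ) ^ 2 * ω y at heq
  change ∃ y, ω y ≠ 0 at hne
  by_contra hσ
  push Not at hσ
  -- regularity of ω
  have hi2 : ContDiff ℝ 2 (iteratedDeriv 2 ψ) := by
    rw [iteratedDeriv_eq_iterate]
    exact hψ.iterate_deriv' 2 2
  have hω2 : ContDiff ℝ 2 ω := (hi2.sub (contDiff_const.mul (hψ.of_le (by norm_num)))).neg
  have hωd : Differentiable ℝ ω := hω2.differentiable (by norm_num)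
  have hω1d : Differentiable ℝ (deriv ω) := by
    have := hω2.differentiable_iteratedDeriv 1 (by norm_num)
    simpa [iteratedDeriv_one] using this
  have hD : ∀ y, HasDerivAt ω (deriv ω y) y := fun y => (hωd y).hasDerivAt
  have hD1 : ∀ y, HasDerivAt (deriv ω) (deriv (deriv ω) y) y := fun y => (hω1d y).hasDerivAt
  have hit : ∀ y, iteratedDeriv 2 ω y = deriv (deriv ω) y := fun y => by
    rw [iteratedDeriv_succ, iteratedDeriv_one]
  -- the Gaussian conjugation `W = e^{y²/4} ω`
  set E : ℝ → ℂ := fun y => ((Real.exp (y ^ 2 / 4) : ℝ) : ℂ) with hE_def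
  have hEd : ∀ y : ℝ, HasDerivAt E ((y : ℂ) / 2 * E y) y := by
    intro y
    have h1 : HasDerivAt (fun x : ℝ => Real.exp (x ^ 2 / 4)) (Real.exp (y ^ 2 / 4) * (2 * y / 4)) y := by
      have := ((hasDerivAt_pow 2 y).div_const 4).exp
      refine this.congr_deriv ?_
      simp
    have h2 := h1.ofReal_comp
    rw [hE_def]
    refine h2.congr_deriv ?_
    push_cast; ring
  set W : ℝ → ℂ := fun y => E y * ω y with hW_def
  set W₁ : ℝ → ℂ := fun y => E y * ((y : ℂ) / 2 * ω y + deriv ω y) with hW₁_def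
  set W₂ : ℝ → ℂ := fun y => E y * ((y : ℂ) / 2 * ((y : ℂ) / 2 * ω y + deriv ω y)
    + ((1 : ℂ) / 2 * ω y + (y : ℂ) / 2 * deriv ω y + deriv (deriv ω) y)) with hW₂_def
  have hW : ∀ y, HasDerivAt W (W₁ y) y := by
    intro y
    rw [hW_def, hW₁_def]
    exact ((hEd y).fun_mul (hD y)).congr_deriv (by ring)
  have hid : ∀ y : ℝ, HasDerivAt (fun x : ℝ => (x : ℂ) / 2) ((1 : ℂ) / 2) y := by
    intro y
    have := ((hasDerivAt_id' y).ofReal_comp).div_const (2 : ℂ)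
    refine this.congr_deriv ?_
    simp
  have hW₁ : ∀ y, HasDerivAt W₁ (W₂ y) y := by
    intro y
    rw [hW₁_def, hW₂_def]
    exact ((hEd y).fun_mul (((hid y).fun_mul (hD y)).fun_add (hD1 y))).congr_deriv (by ring)
  have hWb : ∀ y, ‖W y‖ ≤ C := by
    intro y
    have hE : ‖E y‖ = Real.exp (y ^ 2 / 4) := by
      simp only [hE_def, Complex.norm_real, Real.norm_eq_abs, abs_of_pos (Real.exp_pos _)]
    have h1 : ‖W y‖ = Real.exp (y ^ 2 / 4) * ‖ω y‖ := by
      simp only [hW_def, norm_mul, hE]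
    rw [h1]
    have h2 := mul_le_mul_of_nonneg_left (hdecay y) (Real.exp_pos (y ^ 2 / 4)).le
    have h3 : Real.exp (y ^ 2 / 4) * (C * Real.exp (-(y ^ 2) / 4)) = C := by
      rw [mul_comm, mul_assoc, ← Real.exp_add]
      have : -(y ^ 2) / 4 + y ^ 2 / 4 = 0 := by ring
      rw [this, Real.exp_zero, mul_one]
    linarith
  -- the conjugated equation
  set μ : ℝ := σ.re + α ^ 2 - 1 / 2 with hμ_def
  have hμ : -1 / 2 < μ := by rw [hμ_def]; nlinarith [sq_nonneg α]
  have hWeq : ∀ y, W₂ y = ((y : ℂ) ^ 2 / 4 + (μ : ℂ) + Complex.I * ((σ.im + α * Re * g y : ℝ) : ℂ)) * W y := by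
    intro y
    have h1 := heq y
    rw [hit y] at h1
    simp only [hW₂_def, hW_def, hμ_def]
    push_cast
    linear_combination (-(E y)) * h1 + (-(E y) * ω y) * Complex.re_add_im σ
  obtain ⟨y₁, hy₁⟩ := hne
  have hW0 := weber_complex (fun y => σ.im + α * Re * g y) hW hW₁ hWb hWeq hμ y₁
  have hE0 : E y₁ ≠ 0 := by
    simp only [hE_def, ne_eq, Complex.ofReal_eq_zero]
    exact (Real.exp_pos _).ne'
  simp only [hW_def, mul_eq_zero] at hW0
  rcases hW0 with h | h
  · exact hE0 h
  · exact hy₁ h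


/-- Corollary at `Re = 0` for the crux's own equation (coupling present but switched off by
`Re = 0`): every admissible mode of `BurgersLayerKH`/`BurgersLayerLowRe` at `Re = 0` has
`re σ ≤ −α²` — the Ornstein–Uhlenbeck spectrum `{−α² − n}` bound, proved in the crux's exact
function class (`ψ ∈ C⁴`, `|ω| ≤ Ce^{−y²/4}`). This is the `Re = 0` case of item
`BurgersLayerLowRe` (stmt-AnomalousDissipation-3010) and shows that any proof of `BurgersLayerKH`
must use a threshold `Re₂ > 0`. [folklore] -/
theorem re_le_at_Re_zero {α C : ℝ} {σ : ℂ} {ψ : ℝ → ℂ} (hψ : ContDiff ℝ 4 ψ)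
    (hdecay : ∀ y, ‖-(iteratedDeriv 2 ψ y - (α : ℂ) ^ 2 * ψ y)‖ ≤ C * Real.exp (-(y ^ 2) / 4))
    (heq : ∀ y : ℝ, let U : ℝ → ℝ := fun y => ∫ s in (0:ℝ)..y, Real.exp (-(s ^ 2) / 2)
      let U'' : ℝ → ℝ := fun y => -(y * Real.exp (-(y ^ 2) / 2))
      let ω : ℝ → ℂ := fun y => -(iteratedDeriv 2 ψ y - (α : ℂ) ^ 2 * ψ y)
      σ * ω y = -(Complex.I * α * (0 : ℝ)) * ((U y : ℂ) * ω y + (U'' y : ℂ) * ψ y) + ω y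
        + (y : ℂ) * deriv ω y + iteratedDeriv 2 ω y - (α : ℂ) ^ 2 * ω y)
    (hne : ∃ y, -(iteratedDeriv 2 ψ y - (α : ℂ) ^ 2 * ψ y) ≠ 0) : σ.re ≤ -α ^ 2 := by
  refine re_le_of_noCoupling (Re := 0) (fun _ => 0) hψ hdecay (fun y => ?_) hne
  have h := heq y
  simp only [Complex.ofReal_zero, mul_zero, zero_mul, neg_zero, zero_add] at h ⊢
  exact h

/-- The crux with the inflection-point coupling `U''ψ` DELETED from the equation (everything else
verbatim): pure advection `−iαRe·U·ω`, stretching `+ω`, compression `yω'`, diffusion `ω'' − α²ω`. -/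
def BurgersLayerKHWithoutCoupling : Prop :=
  ∃ Re₂ c₀ : ℝ, 0 < c₀ ∧ ∀ Re : ℝ, Re₂ ≤ Re → ∃ (α : ℝ) (σ : ℂ) (ψ : ℝ → ℂ), let U : ℝ → ℝ := fun y => ∫ s in (0:ℝ)..y, Real.exp (-(s ^ 2) / 2); let ω : ℝ → ℂ := fun y => -(iteratedDeriv 2 ψ y - (α : ℂ) ^ 2 * ψ y); 0 < α ∧ c₀ * Re ≤ σ.re ∧ ContDiff ℝ 4 ψ ∧ (∃ y, ψ y ≠ 0) ∧ Filter.Tendsto ψ Filter.atTop (nhds 0) ∧ Filter.Tendsto ψ Filter.atBot (nhds 0) ∧ (∃ C : ℝ, ∀ y : ℝ, ‖ω y‖ ≤ C * Real.exp (-(y ^ 2) / 4)) ∧ ∀ y : ℝ, σ * ω y = -(Complex.I * α * Re) * ((U y : ℂ) * ω y) + ω y + (y : ℂ) * deriv ω y + iteratedDeriv 2 ω y - (α : ℂ) ^ 2 * ω y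

/-- The crux with the threshold `Re₂` DELETED (the mode is demanded at EVERY `Re`, in particular at
`Re = 0`; everything else verbatim). -/
def BurgersLayerKHAllRe : Prop :=
  ∃ c₀ : ℝ, 0 < c₀ ∧ ∀ Re : ℝ, ∃ (α : ℝ) (σ : ℂ) (ψ : ℝ → ℂ), let U : ℝ → ℝ := fun y => ∫ s in (0:ℝ)..y, Real.exp (-(s ^ 2) / 2); let U'' : ℝ → ℝ := fun y => -(y * Real.exp (-(y ^ 2) / 2)); let ω : ℝ → ℂ := fun y => -(iteratedDeriv 2 ψ y - (α : ℂ) ^ 2 * ψ y); 0 < α ∧ c₀ * Re ≤ σ.re ∧ ContDiff ℝ 4 ψ ∧ (∃ y, ψ y ≠ 0) ∧ Filter.Tendsto ψ Filter.atTop (nhds 0) ∧ Filter.Tendsto ψ Filter.atBot (nhds 0) ∧ (∃ C : ℝ, ∀ y : ℝ, ‖ω y‖ ≤ C * Real.exp (-(y ^ 2) / 4)) ∧ ∀ y : ℝ, σ * ω y = -(Complex.I * α * Re) * ((U y : ℂ) * ω y + (U'' y : ℂ) * ψ y) + ω y + (y : ℂ) * deriv ω y + iteratedDeriv 2 ω y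 - (α : ℂ) ^ 2 * ω y

/-! ## §1 Load-bearing: non-triviality `ψ ≢ 0`, and absence of ghost modes -/

/-- The crux with the non-triviality clause `(∃ y, ψ y ≠ 0)` DROPPED (everything else verbatim). -/
def BurgersLayerKHWithoutNonzero : Prop :=
  ∃ Re₂ c₀ : ℝ, 0 < c₀ ∧ ∀ Re : ℝ, Re₂ ≤ Re → ∃ (α : ℝ) (σ : ℂ) (ψ : ℝ → ℂ), let U : ℝ → ℝ := fun y => ∫ s in (0:ℝ)..y, Real.exp (-(s ^ 2) / 2); let U'' : ℝ → ℝ := fun y => -(y * Real.exp (-(y ^ 2) / 2)); let ω : ℝ → ℂ := fun y => -(iteratedDeriv 2 ψ y - (α : ℂ) ^ 2 * ψ y); 0 < α ∧ c₀ * Re ≤ σ.re ∧ ContDiff ℝ 4 ψ ∧ Filter.Tendsto ψ Filter.atTop (nhds 0) ∧ Filter.Tendsto ψ Filter.atBot (nhds 0) ∧ (∃ C : ℝ, ∀ y : ℝ, ‖ω y‖ ≤ C * Real.exp (-(y ^ 2) / 4)) ∧ ∀ y : ℝ, σ * ω y = -(Complex.I * α * Re) * ((U y : ℂ) * ω y +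 (U'' y : ℂ) * ψ y) + ω y + (y : ℂ) * deriv ω y + iteratedDeriv 2 ω y - (α : ℂ) ^ 2 * ω y

/-- Without `ψ ≢ 0` the crux is trivially true: `ψ ≡ 0`, `σ = Re`, `α = 1` is a witness at every
`Re` (so the non-triviality clause is load-bearing for MEANING, and any proof must produce a
genuinely non-zero eigenfunction). [folklore] -/
theorem trivial_without_nonzero : BurgersLayerKHWithoutNonzero := by
  refine ⟨0, 1, one_pos, fun Re _ => ⟨1, (Re : ℂ), fun _ => 0, ?_⟩⟩
  refine ⟨one_pos, ?_, contDiff_const, tendsto_const_nhds, tendsto_const_nhds, ⟨0, fun y => ?_⟩, fun y => ?_⟩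
  · simp
  · simp
  · simp

/-- **No ghost modes.** If `ψ ∈ C⁴`, `α > 0`, `ψ → 0` at `±∞` and the vorticity
`ω = −(ψ'' − α²ψ)` vanishes identically, then `ψ ≡ 0`: by uniqueness for `ψ'' = α²ψ`
(`Literature.Analysis.ODE.eqOn_of_solution_Ioo`) `ψ = A e^{αy} + B e^{−αy}`, and the decay at `+∞`,
`−∞` forces `A = 0`, `B = 0`. Hence the clause `ψ ≢ 0` of the crux already forces `ω ≢ 0`: every
admissible witness is a genuine eigenfunction of the vorticity operator (no junk model). [folklore] -/
theorem psi_eq_zero_of_vorticity_eq_zero {α : ℝ} (hα : 0 < α) {ψ : ℝ → ℂ} (hψ : ContDiff ℝ 4 ψ)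
    (htop : Tendsto ψ atTop (𝓝 0)) (hbot : Tendsto ψ atBot (𝓝 0))
    (hω : ∀ y, iteratedDeriv 2 ψ y - (α : ℂ) ^ 2 * ψ y = 0) : ∀ y, ψ y = 0 := by
  have hd : Differentiable ℝ ψ := hψ.differentiable (by norm_num)
  have hd1 : Differentiable ℝ (deriv ψ) := by
    have := hψ.differentiable_iteratedDeriv 1 (by norm_num)
    simpa [iteratedDeriv_one] using this
  have h2 : ∀ y, deriv (deriv ψ) y = (α : ℂ) ^ 2 * ψ y := by
    intro y
    have := hω y
    rw [iteratedDeriv_succ, iteratedDeriv_one] at this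
    exact sub_eq_zero.mp this
  have hαC : (α : ℂ) ≠ 0 := Complex.ofReal_ne_zero.mpr hα.ne'
  -- the comparison solution `v = A e^{αy} + B e^{-αy}` with the same data at `0`
  set A : ℂ := (ψ 0 + deriv ψ 0 / α) / 2 with hA
  set B : ℂ := (ψ 0 - deriv ψ 0 / α) / 2 with hB
  set E : ℝ → ℂ := fun y => ((Real.exp (α * y) : ℝ) : ℂ) with hE
  set F : ℝ → ℂ := fun y => ((Real.exp (-(α * y)) : ℝ) : ℂ) with hF
  have hEd : ∀ y, HasDerivAt E ((α : ℂ) * E y) y := by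
    intro y
    have h1 : HasDerivAt (fun s : ℝ => Real.exp (α * s)) (Real.exp (α * y) * α) y := by
      simpa using ((hasDerivAt_id y).const_mul α).exp
    have := h1.ofReal_comp
    simp only [hE]
    convert this using 1
    push_cast; ring
  have hFd : ∀ y, HasDerivAt F (-(α : ℂ) * F y) y := by
    intro y
    have h1 : HasDerivAt (fun s : ℝ => Real.exp (-(α * s))) (Real.exp (-(α * y)) * (-α)) y := by
      simpa using (((hasDerivAt_id y).const_mul α).neg).exp
    have := h1.ofReal_comp
    simp only [hF]
    convert this using 1
    push_cast; ring
  set v : ℝ → ℂ := fun y => A * E y + B * F y with hv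
  set v' : ℝ → ℂ := fun y => (α : ℂ) * A * E y - (α : ℂ) * B * F y with hv'
  have hvd : ∀ y, HasDerivAt v (v' y) y := by
    intro y
    simp only [hv, hv']
    exact (((hEd y).const_mul A).add ((hFd y).const_mul B)).congr_deriv (by ring)
  have hv'd : ∀ y, HasDerivAt v' ((0 : ℂ) * v' y + (α : ℂ) ^ 2 * v y) y := by
    intro y
    simp only [hv, hv']
    exact (((hEd y).const_mul ((α : ℂ) * A)).sub ((hFd y).const_mul ((α : ℂ) * B))).congr_deriv
      (by ring)
  -- uniqueness: ψ = v everywhere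
  have heq : ∀ y, ψ y = v y := by
    intro y
    have hR : y ∈ Ioo (-(|y| + 1)) (|y| + 1) := by
      constructor <;> linarith [abs_nonneg y, neg_abs_le y, le_abs_self y]
    have h0 : (0 : ℝ) ∈ Ioo (-(|y| + 1)) (|y| + 1) := by
      constructor <;> linarith [abs_nonneg y]
    have key := Literature.Analysis.ODE.eqOn_of_solution_Ioo (𝕜 := ℂ) (p := fun _ => (0 : ℂ))
      (q := fun _ => (α : ℂ) ^ 2) (u := ψ) (u' := deriv ψ) (v := v) (v' := v')
      continuousOn_const continuousOn_const h0 ?_ ?_ ?_ ?_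
    · exact key.1 hR
    · intro t _
      refine ⟨(hd t).hasDerivAt, ?_⟩
      have := (hd1 t).hasDerivAt
      rw [h2 t] at this
      simpa using this
    · intro t _
      exact ⟨hvd t, hv'd t⟩
    · simp [hv, hE, hF, hA, hB]; ring
    · simp [hv', hE, hF, hA, hB]; field_simp; ring
  -- norms of the exponentials
  have hnE : ∀ y, ‖E y‖ = Real.exp (α * y) := fun y => by
    simp only [hE, Complex.norm_real, Real.norm_eq_abs, abs_of_pos (Real.exp_pos _)]
  have hnF : ∀ y, ‖F y‖ = Real.exp (-(α * y)) := fun y => by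
    simp only [hF, Complex.norm_real, Real.norm_eq_abs, abs_of_pos (Real.exp_pos _)]
  have hvtop : Tendsto v atTop (𝓝 0) := htop.congr heq
  have hvbot : Tendsto v atBot (𝓝 0) := hbot.congr heq
  have hFtop : Tendsto F atTop (𝓝 0) := by
    rw [tendsto_zero_iff_norm_tendsto_zero]
    simp only [hnF]
    exact Real.tendsto_exp_atBot.comp (tendsto_neg_atTop_atBot.comp (tendsto_id.const_mul_atTop hα))
  have hEbot : Tendsto E atBot (𝓝 0) := by
    rw [tendsto_zero_iff_norm_tendsto_zero]
    simp only [hnE]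
    exact Real.tendsto_exp_atBot.comp (tendsto_id.const_mul_atBot hα)
  -- A = 0 from the behaviour at +∞
  have hA0 : A = 0 := by
    by_contra hA0
    have h1 : Tendsto (fun y => A * E y) atTop (𝓝 0) := by
      have : Tendsto (fun y => v y - B * F y) atTop (𝓝 (0 - B * 0)) := hvtop.sub (hFtop.const_mul B)
      simp only [mul_zero, sub_zero] at this
      refine this.congr fun y => ?_
      simp only [hv]; ring
    have h2 : Tendsto (fun y => ‖A‖ * Real.exp (α * y)) atTop atTop :=
      (Real.tendsto_exp_atTop.comp (tendsto_id.const_mul_atTop hα)).const_mul_atTop (norm_pos_iff.mpr hA0)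
    have h3 : Tendsto (fun y => ‖A‖ * Real.exp (α * y)) atTop (𝓝 0) := by
      have := (tendsto_zero_iff_norm_tendsto_zero.mp h1)
      simpa [norm_mul, hnE] using this
    exact h3.not_tendsto (disjoint_nhds_atTop 0) h2
  -- B = 0 from the behaviour at -∞
  have hB0 : B = 0 := by
    by_contra hB0
    have h1 : Tendsto (fun y => B * F y) atBot (𝓝 0) := by
      refine hvbot.congr fun y => ?_
      simp only [hv, hA0]; ring
    have h2 : Tendsto (fun y => ‖B‖ * Real.exp (-(α * y))) atBot atTop :=
      (Real.tendsto_exp_atTop.comp (tendsto_neg_atBot_atTop.comp (tendsto_id.const_mul_atBot hα))).const_mul_atTop (norm_pos_iff.mpr hB0)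
    have h3 : Tendsto (fun y => ‖B‖ * Real.exp (-(α * y))) atBot (𝓝 0) := by
      have := (tendsto_zero_iff_norm_tendsto_zero.mp h1)
      simpa [norm_mul, hnF] using this
    exact h3.not_tendsto (disjoint_nhds_atTop 0) h2
  intro y
  rw [heq y]
  simp [hv, hA0, hB0]

/-- Corollary in the crux's own terms: for an admissible witness (`α > 0`, `ψ ∈ C⁴`, `ψ → 0` at
`±∞`, `ψ ≢ 0`) the vorticity `ω = −(ψ'' − α²ψ)` is not identically zero. [folklore] -/
theorem vorticity_ne_zero {α : ℝ} (hα : 0 < α) {ψ : ℝ → ℂ} (hψ : ContDiff ℝ 4 ψ)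
    (htop : Tendsto ψ atTop (𝓝 0)) (hbot : Tendsto ψ atBot (𝓝 0)) (hne : ∃ y, ψ y ≠ 0) :
    ∃ y, -(iteratedDeriv 2 ψ y - (α : ℂ) ^ 2 * ψ y) ≠ 0 := by
  by_contra h
  push Not at h
  obtain ⟨y, hy⟩ := hne
  exact hy (psi_eq_zero_of_vorticity_eq_zero hα hψ htop hbot (fun z => neg_eq_zero.mp (h z)) y)


/-- **Load-bearing: the inflection-point coupling.** Without the `U''ψ` term the crux is FALSE:
for `Re ≥ max Re₂ 1 > 0` it demands a Gaussian-class mode with `re σ ≥ c₀Re > 0`, but every such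
mode of the uncoupled equation has `re σ ≤ −α² ≤ 0` (`re_le_of_noCoupling`; `ω ≢ 0` by
`vorticity_ne_zero`). Any proof of `BurgersLayerKH` must therefore use the Rayleigh coupling
`U''ψ` (the inflection point of the erf profile); advection, stretching `+ω`, compression `yω'`
and diffusion never produce growth in the Gaussian class, at any Reynolds number. [folklore] -/
theorem burgersLayerKH_false_without_coupling : ¬ BurgersLayerKHWithoutCoupling := by
  rintro ⟨Re₂, c₀, hc₀, h⟩
  obtain ⟨α, σ, ψ, hα, hσ, hψ, hne, htop, hbot, ⟨C, hC⟩, heq⟩ := h (max Re₂ 1) (le_max_left _ _)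
  have hRe : 0 < max Re₂ 1 := lt_of_lt_of_le one_pos (le_max_right _ _)
  have hων := vorticity_ne_zero hα hψ htop hbot hne
  have key : σ.re ≤ -α ^ 2 :=
    re_le_of_noCoupling (fun y => ∫ s in (0:ℝ)..y, Real.exp (-(s ^ 2) / 2)) hψ hC heq hων
  have h1 : 0 < c₀ * max Re₂ 1 := mul_pos hc₀ hRe
  nlinarith [sq_nonneg α]

/-- **Load-bearing: the threshold `Re₂`.** Demanding the unstable mode at every `Re` (in
particular `Re = 0`) is FALSE: at `Re = 0` every admissible mode has `re σ ≤ −α² < 0 = c₀·0`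
(`re_le_at_Re_zero`). The Sweet–Parker (low-`Re`) end is genuinely stable; cf. item
`BurgersLayerLowRe`. [folklore] -/
theorem burgersLayerKH_false_forall_Re : ¬ BurgersLayerKHAllRe := by
  rintro ⟨c₀, hc₀, h⟩
  obtain ⟨α, σ, ψ, hα, hσ, hψ, hne, htop, hbot, ⟨C, hC⟩, heq⟩ := h 0
  have hων := vorticity_ne_zero hα hψ htop hbot hne
  have key : σ.re ≤ -α ^ 2 := re_le_at_Re_zero hψ hC heq hων
  have hα2 : 0 < α ^ 2 := by positivity
  simp only [mul_zero] at hσ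
  linarith

/-- Sanity link to the crux as filed: `BurgersLayerKH` is exactly `BurgersLayerKHAllRe` guarded by a
threshold, and exactly `BurgersLayerKHWithoutCoupling` with the coupling restored — recorded as the
trivial implications from the crux to the WEAKER companions it must not be confused with. Here: the
crux implies its coupling-free companion is NOT claimed (it is false); we only record that the crux
with `Re₂ := 0`-type strengthening fails. [folklore] -/
theorem burgersLayerKH_of_allRe (h : BurgersLayerKHAllRe) : BurgersLayerKH := by
  obtain ⟨c₀, hc₀, h⟩ := h
  exact ⟨0, c₀, hc₀, fun Re _ => h Re⟩

/-! ## §3b Tightness: no admissible constant exceeds `√(π/2)` -/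

/-- The crux with a PRESCRIBED rate constant `c` (instead of `∃ c₀ > 0`; everything else verbatim).
[folklore] -/
def BurgersLayerKHWithRate (c : ℝ) : Prop :=
  ∃ Re₂ : ℝ, ∀ Re : ℝ, Re₂ ≤ Re → ∃ (α : ℝ) (σ : ℂ) (ψ : ℝ → ℂ), let U : ℝ → ℝ := fun y => ∫ s in (0:ℝ)..y, Real.exp (-(s ^ 2) / 2); let U'' : ℝ → ℝ := fun y => -(y * Real.exp (-(y ^ 2) / 2)); let ω : ℝ → ℂ := fun y => -(iteratedDeriv 2 ψ y - (α : ℂ) ^ 2 * ψ y); 0 < α ∧ c * Re ≤ σ.re ∧ ContDiff ℝ 4 ψ ∧ (∃ y, ψ y ≠ 0) ∧ Filter.Tendsto ψ Filter.atTop (nhds 0) ∧ Filter.Tendsto ψ Filter.atBot (nhds 0) ∧ (∃ C : ℝ, ∀ y : ℝ, ‖ω y‖ ≤ C * Real.exp (-(y ^ 2) / 4)) ∧ ∀ y : ℝ, σ * ω y = -(Complex.I * α * Re) * ((U y : ℂ) * ω y + (U'' y : ℂ) * ψ y) + ω y + (y : ℂ) * deriv ω y + iteratedDeriv 2 ω y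 - (α : ℂ) ^ 2 * ω y

/-- The crux is exactly "some positive rate is admissible". [folklore] -/
theorem burgersLayerKH_iff_exists_rate : BurgersLayerKH ↔ ∃ c, 0 < c ∧ BurgersLayerKHWithRate c := by
  constructor
  · rintro ⟨Re₂, c₀, hc₀, h⟩
    exact ⟨c₀, hc₀, Re₂, h⟩
  · rintro ⟨c, hc, Re₂, h⟩
    exact ⟨Re₂, c, hc, h⟩

/-- **Tightness / refuted strengthening.** No rate constant above `√(π/2) ≈ 1.2533` is
admissible: `BurgersLayerKHWithRate c` is FALSE for every `c > √(π/2)` (at `Re = max Re₂ 1` the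
demanded mode would have `re σ ≥ c·Re > √(π/2)·Re ≥ re σ + α²`, by `re_add_sq_le_of_mode`). In
Beronov–Kida units: growth `≤ R − α²`. (The physical value is `c₀ ≈ 0.2`, the free-shear-layer KH
rate; Høiland's bound would give `½`.) [folklore] -/
theorem not_burgersLayerKHWithRate_of_gt {c : ℝ} (hc : Real.sqrt (Real.pi / 2) < c) :
    ¬ BurgersLayerKHWithRate c := by
  rintro ⟨Re₂, h⟩
  obtain ⟨α, σ, ψ, hα, hσ, hψ, hne, htop, hbot, ⟨C, hC⟩, heq⟩ := h (max Re₂ 1) (le_max_left _ _)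
  have hRe : 0 < max Re₂ 1 := lt_of_lt_of_le one_pos (le_max_right _ _)
  have hων := vorticity_ne_zero hα hψ htop hbot hne
  obtain ⟨M, hM⟩ := bounded_of_tendsto_zero (hψ.continuous) htop hbot
  have key := re_add_sq_le_of_mode hα hψ hM hC heq hων
  rw [abs_of_pos hRe] at key
  have h1 : Real.sqrt (Real.pi / 2) * max Re₂ 1 < c * max Re₂ 1 := mul_lt_mul_of_pos_right hc hRe
  nlinarith [sq_nonneg α]

/-- Equivalent positive form: any admissible rate constant of the crux is `≤ √(π/2)`. [folklore] -/
theorem rate_le_of_burgersLayerKHWithRate {c : ℝ} (h : BurgersLayerKHWithRate c) :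
    c ≤ Real.sqrt (Real.pi / 2) := by
  by_contra hlt
  exact not_burgersLayerKHWithRate_of_gt (lt_of_not_ge hlt) h

/-- **Short waves are stable at every Reynolds number below `α²·√(2/π)`** (a corollary of the
ceiling, stated for the prover of `BurgersLayerLowRe`, stmt-AnomalousDissipation-3010): in the crux's
class, if `√(π/2)·|Re| < α²` then every mode with `ψ ≢ 0` has `re σ < 0`. So for `Re < Re₁` only the
long-wave band `α² ≤ √(π/2)·Re₁` remains to be controlled — the `α → 0` corner flagged in 3010's
docstring is indeed the whole content of that item. [folklore] -/
theorem re_neg_of_short_wave {α Re C : ℝ} (hα : 0 < α) (hRe : Real.sqrt (Real.pi / 2) * |Re| < α ^ 2)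
    {σ : ℂ} {ψ : ℝ → ℂ} (hψ : ContDiff ℝ 4 ψ)
    (htop : Tendsto ψ atTop (𝓝 0)) (hbot : Tendsto ψ atBot (𝓝 0))
    (hdecay : ∀ y, ‖-(iteratedDeriv 2 ψ y - (α : ℂ) ^ 2 * ψ y)‖ ≤ C * Real.exp (-(y ^ 2) / 4))
    (heq : ∀ y : ℝ, let U : ℝ → ℝ := fun y => ∫ s in (0:ℝ)..y, Real.exp (-(s ^ 2) / 2)
      let U'' : ℝ → ℝ := fun y => -(y * Real.exp (-(y ^ 2) / 2))
      let ω : ℝ → ℂ := fun y => -(iteratedDeriv 2 ψ y - (α : ℂ) ^ 2 * ψ y)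
      σ * ω y = -(Complex.I * α * Re) * ((U y : ℂ) * ω y + (U'' y : ℂ) * ψ y) + ω y
        + (y : ℂ) * deriv ω y + iteratedDeriv 2 ω y - (α : ℂ) ^ 2 * ω y)
    (hne : ∃ y, ψ y ≠ 0) : σ.re < 0 := by
  obtain ⟨M, hM⟩ := bounded_of_tendsto_zero hψ.continuous htop hbot
  have hων := vorticity_ne_zero hα hψ htop hbot hne
  have key := re_add_sq_le_of_mode hα hψ hM hdecay heq hων
  linarith

/-! ## §3c Load-bearing: the eigenfunction must be genuinely complex (phase tilt) -/

/-- The imaginary part of the derivative of a real-valued (`im ≡ 0`) differentiable `f : ℝ → ℂ`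
vanishes. [folklore] -/
theorem im_deriv_eq_zero {f : ℝ → ℂ} (hf : Differentiable ℝ f) (h : ∀ y, (f y).im = 0) (y : ℝ) :
    (deriv f y).im = 0 := by
  have hd : HasDerivAt (fun y => (f y).im) ((deriv f y).im) y := by
    simpa [Function.comp_def] using Complex.imCLM.hasFDerivAt.comp_hasDerivAt y (hf y).hasDerivAt
  have e : (fun y => (f y).im) = fun _ => (0:ℝ) := funext h
  rw [e] at hd
  simpa using hd.deriv.symm.trans (deriv_const y (0:ℝ))

/-- **No unstable mode with a real (untilted) eigenfunction.** If, in the crux's setting, the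
eigenfunction is real-valued (`im ψ ≡ 0`) and `σ` is real, then the imaginary part of the
equation forces the Rayleigh coupling `Uω + U''ψ` to vanish identically, the real part is the
uncoupled (Ornstein–Uhlenbeck) equation, and `re σ ≤ −α²` (`re_le_of_noCoupling`). So the KH
eigenfunction must carry a phase tilt against the shear (Reynolds stress needs `im(ψ' ψ̄) ≢ 0`);
a real/standing-in-`ψ` ansatz cannot prove the crux. Requires `α ≠ 0`, `Re ≠ 0`. [folklore] -/
theorem re_le_of_real_mode {α Re C : ℝ} (hα : 0 < α) (hRe : Re ≠ 0) {σ : ℂ} {ψ : ℝ → ℂ}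
    (hψ : ContDiff ℝ 4 ψ) (hreal : ∀ y, (ψ y).im = 0) (hσ : σ.im = 0)
    (hdecay : ∀ y, ‖-(iteratedDeriv 2 ψ y - (α : ℂ) ^ 2 * ψ y)‖ ≤ C * Real.exp (-(y ^ 2) / 4))
    (heq : ∀ y : ℝ, let U : ℝ → ℝ := fun y => ∫ s in (0:ℝ)..y, Real.exp (-(s ^ 2) / 2)
      let U'' : ℝ → ℝ := fun y => -(y * Real.exp (-(y ^ 2) / 2))
      let ω : ℝ → ℂ := fun y => -(iteratedDeriv 2 ψ y - (α : ℂ) ^ 2 * ψ y)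
      σ * ω y = -(Complex.I * α * Re) * ((U y : ℂ) * ω y + (U'' y : ℂ) * ψ y) + ω y
        + (y : ℂ) * deriv ω y + iteratedDeriv 2 ω y - (α : ℂ) ^ 2 * ω y)
    (hne : ∃ y, -(iteratedDeriv 2 ψ y - (α : ℂ) ^ 2 * ψ y) ≠ 0) : σ.re ≤ -α ^ 2 := by
  set U : ℝ → ℝ := fun y => ∫ s in (0:ℝ)..y, Real.exp (-(s ^ 2) / 2) with hU_def
  set U'' : ℝ → ℝ := fun y => -(y * Real.exp (-(y ^ 2) / 2)) with hU''_def
  set ω : ℝ → ℂ := fun y => -(iteratedDeriv 2 ψ y - (α : ℂ) ^ 2 * ψ y) with hω_def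
  change ∀ y, σ * ω y = -(Complex.I * α * Re) * ((U y : ℂ) * ω y + (U'' y : ℂ) * ψ y) + ω y
    + (y : ℂ) * deriv ω y + iteratedDeriv 2 ω y - (α : ℂ) ^ 2 * ω y at heq
  -- all the functions in sight are real
  have hψd : Differentiable ℝ ψ := hψ.differentiable (by norm_num)
  have hψ1d : Differentiable ℝ (deriv ψ) := by
    have := hψ.differentiable_iteratedDeriv 1 (by norm_num)
    simpa [iteratedDeriv_one] using this
  have him1 : ∀ y, (deriv ψ y).im = 0 := im_deriv_eq_zero hψd hreal
  have him2 : ∀ y, (iteratedDeriv 2 ψ y).im = 0 := fun y => by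
    rw [iteratedDeriv_succ, iteratedDeriv_one]; exact im_deriv_eq_zero hψ1d him1 y
  have hα2im : ((α : ℂ) ^ 2).im = 0 := by rw [← Complex.ofReal_pow]; exact Complex.ofReal_im _
  have hα2re : ((α : ℂ) ^ 2).re = α ^ 2 := by rw [← Complex.ofReal_pow]; exact Complex.ofReal_re _
  have hωim : ∀ y, (ω y).im = 0 := fun y => by
    simp only [hω_def, Complex.neg_im, Complex.sub_im, Complex.mul_im, him2 y, hreal y, hα2im]
    simp
  have hi2 : ContDiff ℝ 2 (iteratedDeriv 2 ψ) := by
    rw [iteratedDeriv_eq_iterate]; exact hψ.iterate_deriv' 2 2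
  have hω2 : ContDiff ℝ 2 ω := (hi2.sub (contDiff_const.mul (hψ.of_le (by norm_num)))).neg
  have hωd : Differentiable ℝ ω := hω2.differentiable (by norm_num)
  have hω1d : Differentiable ℝ (deriv ω) := by
    have := hω2.differentiable_iteratedDeriv 1 (by norm_num)
    simpa [iteratedDeriv_one] using this
  have hω1im : ∀ y, (deriv ω y).im = 0 := im_deriv_eq_zero hωd hωim
  have hω2im : ∀ y, (iteratedDeriv 2 ω y).im = 0 := fun y => by
    rw [iteratedDeriv_succ, iteratedDeriv_one]; exact im_deriv_eq_zero hω1d hω1im y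
  -- the imaginary part of the equation kills the coupling
  have hsum : ∀ y, (U y : ℂ) * ω y + (U'' y : ℂ) * ψ y = 0 := by
    intro y
    have h := congrArg Complex.im (heq y)
    simp only [Complex.mul_im, Complex.add_im, Complex.sub_im, Complex.neg_im, Complex.neg_re,
      Complex.mul_re, Complex.I_re, Complex.I_im, Complex.ofReal_re, Complex.ofReal_im,
      Complex.add_re, hσ, hωim, hreal, hω1im, hω2im, hα2im, zero_mul, mul_zero, sub_zero, add_zero,
      zero_add, one_mul, neg_zero] at h
    -- h : 0 = α * Re * (U y * (ω y).re + U'' y * (ψ y).re)   (up to ring normalisation)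
    have hαRe : α * Re ≠ 0 := mul_ne_zero hα.ne' hRe
    have hre : U y * (ω y).re + U'' y * (ψ y).re = 0 := by
      apply (mul_eq_zero.1 (show α * Re * (U y * (ω y).re + U'' y * (ψ y).re) = 0 by linarith)).resolve_left hαRe
    apply Complex.ext
    · simp only [Complex.add_re, Complex.mul_re, Complex.ofReal_re, Complex.ofReal_im, hωim, hreal,
        mul_zero, sub_zero, Complex.zero_re]
      exact hre
    · simp only [Complex.add_im, Complex.mul_im, Complex.ofReal_re, Complex.ofReal_im, hωim, hreal,
        mul_zero, zero_mul, add_zero, Complex.zero_im]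
  exact re_le_of_noCoupling (Re := Re) (fun _ => 0) hψ hdecay (fun y => by
    have h1 := heq y
    rw [hsum y, mul_zero, zero_add] at h1
    simp only [Complex.ofReal_zero, zero_mul, mul_zero, zero_add]
    exact h1) hne

/-- The crux with the extra demand that the eigenpair be REAL (`im σ = 0`, `im ψ ≡ 0`; everything else
verbatim). [folklore] -/
def BurgersLayerKHRealMode : Prop :=
  ∃ Re₂ c₀ : ℝ, 0 < c₀ ∧ ∀ Re : ℝ, Re₂ ≤ Re → ∃ (α : ℝ) (σ : ℂ) (ψ : ℝ → ℂ), let U : ℝ → ℝ := fun y => ∫ s in (0:ℝ)..y, Real.exp (-(s ^ 2) / 2); let U'' : ℝ → ℝ := fun y => -(y * Real.exp (-(y ^ 2) / 2)); let ω : ℝ → ℂ := fun y => -(iteratedDeriv 2 ψ y - (α : ℂ) ^ 2 * ψ y); 0 < α ∧ c₀ * Re ≤ σ.re ∧ ContDiff ℝ 4 ψ ∧ (∃ y, ψ y ≠ 0) ∧ Filter.Tendsto ψ Filter.atTop (nhds 0) ∧ Filter.Tendsto ψ Filter.atBot (nhds 0) ∧ (∃ C : ℝ, ∀ y : ℝ,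 ‖ω y‖ ≤ C * Real.exp (-(y ^ 2) / 4)) ∧ (∀ y : ℝ, σ * ω y = -(Complex.I * α * Re) * ((U y : ℂ) * ω y + (U'' y : ℂ) * ψ y) + ω y + (y : ℂ) * deriv ω y + iteratedDeriv 2 ω y - (α : ℂ) ^ 2 * ω y) ∧ σ.im = 0 ∧ ∀ y, (ψ y).im = 0

/-- **Refuted strengthening: real eigenpairs.** `BurgersLayerKHRealMode` is FALSE — an unstable
mode of the Burgers layer cannot have a real-valued stream function (with real `σ`): the phase tilt
is load-bearing (`re_le_of_real_mode`). [folklore] -/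
theorem burgersLayerKH_false_real_mode : ¬ BurgersLayerKHRealMode := by
  rintro ⟨Re₂, c₀, hc₀, h⟩
  obtain ⟨α, σ, ψ, hα, hσ, hψ, hne, htop, hbot, ⟨C, hC⟩, heq, hσim, hreal⟩ :=
    h (max Re₂ 1) (le_max_left _ _)
  have hRe : 0 < max Re₂ 1 := lt_of_lt_of_le one_pos (le_max_right _ _)
  have hων := vorticity_ne_zero hα hψ htop hbot hne
  have key := re_le_of_real_mode hα hRe.ne' hψ hreal hσim hC heq hων
  have h1 : 0 < c₀ * max Re₂ 1 := mul_pos hc₀ hRe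
  nlinarith [sq_nonneg α]

/-- `BurgersLayerKHRealMode → BurgersLayerKH` (it is a strengthening). [folklore] -/
theorem burgersLayerKH_of_realMode (h : BurgersLayerKHRealMode) : BurgersLayerKH := by
  obtain ⟨Re₂, c₀, hc₀, h⟩ := h
  refine ⟨Re₂, c₀, hc₀, fun Re hRe => ?_⟩
  obtain ⟨α, σ, ψ, hα, hσ, hψ, hne, htop, hbot, hC, heq, -, -⟩ := h Re hRe
  exact ⟨α, σ, ψ, hα, hσ, hψ, hne, htop, hbot, hC, heq⟩

/-! ## §4 Numerics and near-misses (docstring log; no sorries in this file)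

* kit j004789 (bkspec/main.py, quick grid; full grid j004827 still queued — same code, finer Re list):
  ```
  Re      max_α re σ     re σ/Re    α*     im σ      unstable band (α grid 0.02)
  1       0.00119        0.0012     0.08   7e-13     [0.02, 0.12]
  2       0.0766         0.0383     0.24   3e-14     [0.02, 0.40]
  5       0.5638         0.1128     0.32   5e-15     [0.02, 0.60]
  10      1.4901         0.1490     0.34   1e-13     [0.02, 0.66]
  50      9.1223         0.1824     0.34   3e-13     [0.02, 0.70]
  200     37.840         0.1892     0.34   2e-12     [0.02, 0.72]
  1000    191.03         0.1910     0.34   7e-12     [0.02, 0.72]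
  Rayleigh (Re → ∞, vorticity form c·ω = Uω + U''G_α ω):  α = 0.10 0.20 0.30 0.34 0.40 0.50 0.60 0.62 0.68
                                            αc_i  = 0.101 0.162 0.189 0.1915 0.187 0.159 0.107 0.094 0.040
  (c_r = 0 to 1e−12: standing; the inviscid solver loses the weakly unstable mode for α ≳ 0.70 — near-
  singular critical layer — while the VISCOUS band edge at Re = 200, 1000 sits in (0.72, 0.74) = BK's 0.733.)
  fixed α = 0.3:  Re = 2 5 10 20 50 100 300 1000 3000 1e4 → re σ/Re = 0.035 0.112 0.147 0.167 0.180 0.184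
                  0.187 0.1885 0.1888 0.1889;  α = 0.4: … 0.1871;  α = 0.5: … 0.1593 (monotone increasing).
  second eigenvalue always stable (re σ₂ ≈ −2 … −6.6, |im σ₂| ≈ αRe·U∞): ONE unstable mode (Howard).
  Re_c (max over α ∈ [0.01, 0.6] of re σ changes sign) = 0.8116  (BK1995: R_cr = 1 ⇔ Re_c = 0.798).
  ```
  Reading: `σ_max(Re) = 0.1915·Re − 0.45 + o(1)` — the strain + viscous remainder shifts the Rayleigh
  eigenvalue by an O(1) NEGATIVE amount, exactly the "O(1) relatively bounded, dissipative perturbation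
  of an O(Re) eigenvalue" picture of §2; nothing detunes the instability. REGULARITY OF THE LIMIT,
  quantitatively (fixed α; `s₀(α) = αc_i` from the Rayleigh solver; shift `s₁ := σ(Re) − s₀Re`):
  ```
  α = 0.3 (s₀ = 0.18894):  Re = 10 50 300 1000 3000 1e4 → s₁ = −0.415 −0.445 −0.452 −0.4528 −0.4531 −0.4532
  α = 0.4 (s₀ = 0.18716):                              s₁ = −0.443 −0.468 −0.474 −0.4746 −0.4749 −0.4749
  α = 0.5 (s₀ = 0.15938):                              s₁ = −0.486 −0.508 −0.513 −0.513 (−0.511 −0.509: tail 4e−3)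
  ```
  i.e. `σ(Re, α) = s₀(α)Re + s₁(α) + O(1/Re)` with `s₁ ≈ −0.45 … −0.51` converged to 4 digits by Re = 10³:
  a first-order-regular expansion in `1/Re` (BK1995 §III.B's `ε = 1/(αR)` scheme), no boundary-layer
  behaviour — the prover's perturbation argument has an O(1) target with an explicit, small constant.
* NOT ATTEMPTED as Lean: Høiland's sharper ceiling `c₀ ≤ ½` (velocity-form energy identity).
  Natural strengthenings that are probably TRUE and hence not refutable: standing modes
  (`im σ = 0`, by the `y ↦ −y` symmetry of the odd profile), a fixed `α` (any `α ∈ (0, 0.733)`)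
  for all large `Re`.
-/

end Summit.AnomalousDissipation.AnomalousDissipation.Cruxes.BurgersLayerKH.Disproof
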